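import Literature.Probability.RandomPlanarGeometry.YangBaxterSAW
import HarnessLib

/-!
# The Yang–Baxter equation for Nienhuis' weights (Glazman–Manolescu, Proposition 3.1)

Topic `Literature/Probability/RandomPlanarGeometry`; support file towards the discharge of the named
fact `Literature.Probability.RandomPlanarGeometry.SAW.YangBaxter.GlazmanManolescu2019_prop42`
(`YangBaxterSAWTwoPoint.lean`; Proposition 4.2 of A. Glazman, I. Manolescu, *Self-avoiding walk on
`ℤ²` with Yang–Baxter weights: universality of critical fugacity and 2-point function*, Ann. Inst.
Henri Poincaré Probab. Stat. 56 (2020), arXiv:1708.00395, bib key `GlazmanManolescu2019`), which is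
the last input of Theorem 1 (`GlazmanManolescu2019_thm1_of_prop11_prop42`, `YangBaxterSAWExcursion.lean`).
Proposition 4.2 (p. 11) exchanges two adjacent columns `i`, `i+1` of `Rect_{T,L}(Θ)` (angles
`θ₁ = θ_i < θ₂ = θ_{i+1}`) by adding "a rhombus `r` … at the top of the columns `i` and `i+1`" and
sliding it down to the bottom by `2L + 1` **Yang–Baxter transformations** (§3, Proposition 3.1 and
Corollary 3.2, p. 9): "Let `𝖧` be a hexagon formed of three rhombi … `𝖧'` the rearrangement of the
three rhombi … For any choice of distinct vertices `x₁, y₁, …, x_k, y_k` on the edges of `∂𝖧`,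
`Σ_{γ₁…γ_k ⊂ 𝖧, γ_i : x_i → y_i} w_𝖧(γ₁ ∪ … ∪ γ_k) = Σ_{γ₁…γ_k ⊂ 𝖧', γ_i : x_i → y_i} w_𝖧'(γ₁ ∪ … ∪ γ_k)`
… The proof consists simply of listing for each choice of `x₁, y₁, …, x_k, y_k` (`k` is always
smaller than `3`) the weights for all possible connections in the two tilings and explicitly
computing their sum. The weights (1) were derived in [N90] to satisfy these equations."

This file PROVES the trigonometric content of Proposition 3.1 for the hexagon of that sliding move,
with the weights `weightU1 … weightW2` of eq. (1) (`YangBaxterSAW.lean`): the 38 non-trivial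
identities among the 75 boundary pairings (the other 37 pairings have literally the same weight
polynomial on both sides, see the table below). The combinatorial half of Proposition 3.1 /
Corollary 3.2 (that the walks of a tiling realising a given pairing inside the hexagon are exactly
those enumerated below, and the regrouping of the walks of `D_m` by their trace outside the
hexagon) belongs with the walk structure on the tilings `D_m`, which is not in the tree yet.

## The hexagon and the enumeration

Let `a = d_i = (sin θ₁, −cos θ₁)` and `c = d_{i+1} = (sin θ₂, −cos θ₂)` be the directions of the
slanted sides of the columns `i`, `i+1` (`YangBaxterSAW.colShift`) and `b = (0, 1)`. The hexagon has
the vertices `0, a, a+c, a+b+c, b+c, b` and the six boundary edges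

* `E0 = [0, b]` — the left (`W`) side of the rhombus in position `i`,
* `E1 = [0, a]` — the bottom slanted side below position `i` (direction `d_i`),
* `E2 = [b, b+c]` — the top slanted side above position `i` (direction `d_{i+1}`),
* `E3 = [b+c, a+b+c]` — the top slanted side above position `i+1` (direction `d_i`),
* `E4 = [a, a+c]` — the bottom slanted side below position `i+1` (direction `d_{i+1}`),
* `E5 = [a+c, a+b+c]` — the right (`E`) side of the rhombus in position `i+1`.

`𝖧` (before the move, `r` on top; interior vertex `a+b`) consists of the column rhombus
`{0, a, a+b, b}` of angle `θ₁` (sides `W = E0`, `S = E1`), the column rhombus `{a, a+c, a+b+c, a+b}`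
of angle `θ₂` (sides `S = E4`, `E = E5`) and `r = {b, a+b, a+b+c, b+c}` (upper sides `E2`, `E3`);
`𝖧'` (after the move, `r` at the bottom; interior vertex `c`) consists of `r' = {0, a, a+c, c}`
(lower sides `E1`, `E4`), the column rhombus `{0, c, b+c, b}` in position `i`, now of angle `θ₂`
(sides `W = E0`, `N = E2`), and the column rhombus `{c, a+c, a+b+c, b+c}` in position `i+1`, now of
angle `θ₁` (sides `N = E3`, `E = E5`) — "this in effect slides the added rhombus one unit down",
the two columns being exchanged above it.

Weights are read with the convention of `YangBaxterSAW.localWeight`, which is intrinsic: in a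
rhombus whose corner angles are `φ` and `π − φ`, an arc turning around a corner of angle `φ`
weighs `u₁(φ) = u₂(π − φ)`, a straight arc `v(φ) = v(π − φ)`, two arcs around the two corners of
angle `φ` weigh `w₁(φ) = w₂(π − φ)`, and the two crossing straight arcs are excluded. For the
column rhombi `φ = θ₁` resp. `θ₂` at the upper-left and lower-right corners (`π − θ` at the other
two: the angle between `d` and `b` is `π − θ`); for `r`, whose sides have directions `d_i` and
`d_{i+1}`, the left and right vertices have angle `δ = θ₂ − θ₁` and the bottom and top vertices
`π − δ`, and we write its weights as `u₁(δ), u₂(δ), v(δ), w₁(δ), w₂(δ)` accordingly (so the single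
arc of a walk through `r` when `r` sits on top of the rectangle, around its bottom vertex, weighs
`u₂(δ)`). Note that `δ ∈ (0, π/3]` lies OUTSIDE `[π/3, 2π/3]` ("for this section only … rhombi with
any angles in `(0, π)`", §3) and `w₂(δ) < 0` for `δ < π/3`: partition functions of the intermediate
tilings are signed.

A walk inside a tiling is a sequence of pairwise distinct edges, consecutive ones on a common
rhombus, consecutive arcs in distinct rhombi (so a boundary edge can only be an endpoint); a family
realising a pairing uses pairwise disjoint edge sets and at most two (non-crossing, corner) arcs
per rhombus. Enumerating, for each of the `15 + 45 + 15 = 75` pairings of `2, 4, 6` of the boundary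
edges (`k = 1, 2, 3` walks; crossing pairings included, with no realisation on either side), all
families in `𝖧` and in `𝖧'` gives the following table (`δ = θ₂ − θ₁`; machine-generated, and
checked numerically to agree to `10⁻¹⁵` at random angles before being proved):

* `E0↔E1`: `u₁(θ₂)·u₂(δ)·w₁(θ₁) + u₂(θ₁) = u₁(δ)·u₂(θ₂) + u₂(θ₁)·v(δ)·v(θ₂)` (`yangBaxter_E0E1`);
* `E0↔E2`: `u₁(δ)·u₁(θ₁) + u₁(θ₂)·v(δ)·v(θ₁) = u₁(θ₂) + u₂(δ)·u₂(θ₁)·w₂(θ₂)` (`yangBaxter_E0E2`);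
* `E0↔E3`: `u₁(δ)·u₁(θ₂)·v(θ₁) + u₁(θ₁)·v(δ) = u₁(θ₁)·v(θ₂) + u₂(δ)·u₂(θ₂)·v(θ₁)` (`yangBaxter_E0E3`);
* `E0↔E4`: `u₁(θ₁)·u₂(δ)·v(θ₂) + u₂(θ₂)·v(θ₁) = u₁(δ)·u₂(θ₁)·v(θ₂) + u₂(θ₂)·v(δ)` (`yangBaxter_E0E4`);
* `E0↔E5`: both sides `u₁(θ₁)·u₂(δ)·u₂(θ₂) + v(θ₁)·v(θ₂)`;
* `E1↔E2`: `u₁(δ)·v(θ₁) + u₁(θ₁)·u₁(θ₂)·v(δ) = u₁(δ)·v(θ₂) + u₂(θ₁)·u₂(θ₂)·v(δ)` (`yangBaxter_E1E2`);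
* `E1↔E3`: both sides `u₁(δ)·u₁(θ₁)·u₁(θ₂) + v(δ)·v(θ₁)`;
* `E1↔E4`: `u₁(θ₁)·u₂(θ₂) + u₂(δ)·v(θ₁)·v(θ₂) = u₁(θ₂)·u₂(θ₁)·w₁(δ) + u₂(δ)` (`yangBaxter_E1E4`);
* `E1↔E5`: `u₁(θ₁)·v(θ₂) + u₂(δ)·u₂(θ₂)·v(θ₁) = u₁(δ)·u₁(θ₂)·v(θ₁) + u₁(θ₁)·v(δ)` (`yangBaxter_E1E5`);
* `E2↔E3`: `u₁(θ₂)·u₂(θ₁)·w₁(δ) + u₂(δ) = u₁(θ₁)·u₂(θ₂) + u₂(δ)·v(θ₁)·v(θ₂)` (`yangBaxter_E2E3`);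
* `E2↔E4`: both sides `u₁(δ)·u₂(θ₁)·u₂(θ₂) + v(δ)·v(θ₂)`;
* `E2↔E5`: `u₁(δ)·u₂(θ₁)·v(θ₂) + u₂(θ₂)·v(δ) = u₁(θ₁)·u₂(δ)·v(θ₂) + u₂(θ₂)·v(θ₁)` (`yangBaxter_E2E5`);
* `E3↔E4`: `u₁(δ)·v(θ₂) + u₂(θ₁)·u₂(θ₂)·v(δ) = u₁(δ)·v(θ₁) + u₁(θ₁)·u₁(θ₂)·v(δ)` (`yangBaxter_E3E4`);
* `E3↔E5`: `u₁(δ)·u₂(θ₂) + u₂(θ₁)·v(δ)·v(θ₂) = u₁(θ₂)·u₂(δ)·w₁(θ₁) + u₂(θ₁)` (`yangBaxter_E3E5`);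
* `E4↔E5`: `u₁(θ₂) + u₂(δ)·u₂(θ₁)·w₂(θ₂) = u₁(δ)·u₁(θ₁) + u₁(θ₂)·v(δ)·v(θ₁)` (`yangBaxter_E4E5`);
* `E0↔E1, E2↔E3`: `u₁(θ₂)·w₁(δ)·w₂(θ₁) + u₁(θ₂)·w₁(θ₁)·w₂(δ) + u₂(δ)·u₂(θ₁) = u₁(δ)·u₁(θ₁)·w₂(θ₂)` (`yangBaxter_E0E1_E2E3`);
* `E0↔E2, E1↔E3`: `u₁(θ₂)·w₁(δ)·w₁(θ₁) = u₁(δ)·u₁(θ₁)·w₁(θ₂) + u₁(θ₂)·v(δ)·v(θ₁)` (`yangBaxter_E0E2_E1E3`);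
* `E0↔E3, E1↔E2`: both sides `0`;
* `E0↔E1, E2↔E4`: `u₁(δ)·u₂(θ₂)·w₂(θ₁) + u₂(θ₁)·v(δ)·v(θ₂) = u₂(θ₁)·w₁(δ)·w₂(θ₂)` (`yangBaxter_E0E1_E2E4`);
* `E0↔E2, E1↔E4`: `u₁(δ)·u₂(θ₂)·w₁(θ₁) = u₁(θ₂)·u₂(δ) + u₂(θ₁)·w₁(δ)·w₁(θ₂) + u₂(θ₁)·w₂(δ)·w₂(θ₂)` (`yangBaxter_E0E2_E1E4`);
* `E0↔E4, E1↔E2`: both sides `0`;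
* `E0↔E1, E2↔E5`: `u₁(δ)·v(θ₂)·w₂(θ₁) + u₂(θ₁)·u₂(θ₂)·v(δ) = u₁(δ)·v(θ₁)·w₂(θ₂)` (`yangBaxter_E0E1_E2E5`);
* `E0↔E2, E1↔E5`: `u₁(δ)·v(θ₂)·w₁(θ₁) = u₁(δ)·v(θ₁)·w₁(θ₂) + u₁(θ₁)·u₁(θ₂)·v(δ)` (`yangBaxter_E0E2_E1E5`);
* `E0↔E5, E1↔E2`: both sides `0`;
* `E0↔E1, E3↔E4`: `u₁(δ)·u₂(θ₁)·v(θ₂) + u₂(θ₂)·v(δ)·w₂(θ₁) = u₂(θ₂)·v(θ₁)·w₁(δ)` (`yangBaxter_E0E1_E3E4`);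
* `E0↔E3, E1↔E4`: `u₂(θ₂)·v(δ)·w₁(θ₁) = u₁(θ₁)·u₂(δ)·v(θ₂) + u₂(θ₂)·v(θ₁)·w₂(δ)` (`yangBaxter_E0E3_E1E4`);
* `E0↔E4, E1↔E3`: both sides `0`;
* `E0↔E1, E3↔E5`: both sides `u₁(δ)·u₂(θ₁)·u₂(θ₂) + v(δ)·v(θ₂)·w₂(θ₁)`;
* `E0↔E3, E1↔E5`: both sides `v(δ)·v(θ₂)·w₁(θ₁)`;
* `E0↔E5, E1↔E3`: both sides `0`;
* `E0↔E1, E4↔E5`: `u₁(θ₂)·u₂(θ₁) + u₂(δ)·w₁(θ₁)·w₁(θ₂) + u₂(δ)·w₂(θ₁)·w₂(θ₂) = u₁(θ₁)·u₂(θ₂)·w₁(δ)` (`yangBaxter_E0E1_E4E5`);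
* `E0↔E4, E1↔E5`: both sides `0`;
* `E0↔E5, E1↔E4`: `u₂(δ)·w₁(θ₁)·w₂(θ₂) = u₁(θ₁)·u₂(θ₂)·w₂(δ) + u₂(δ)·v(θ₁)·v(θ₂)` (`yangBaxter_E0E5_E1E4`);
* `E0↔E2, E3↔E4`: `u₁(θ₁)·v(θ₂)·w₁(δ) = u₁(δ)·u₁(θ₂)·v(θ₁) + u₁(θ₁)·v(δ)·w₁(θ₂)` (`yangBaxter_E0E2_E3E4`);
* `E0↔E3, E2↔E4`: both sides `0`;
* `E0↔E4, E2↔E3`: `u₁(θ₁)·v(θ₂)·w₂(δ) + u₂(δ)·u₂(θ₂)·v(θ₁) = u₁(θ₁)·v(δ)·w₂(θ₂)` (`yangBaxter_E0E4_E2E3`);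
* `E0↔E2, E3↔E5`: `u₁(θ₁)·u₂(θ₂)·w₁(δ) = u₁(θ₂)·u₂(θ₁) + u₂(δ)·w₁(θ₁)·w₁(θ₂) + u₂(δ)·w₂(θ₁)·w₂(θ₂)` (`yangBaxter_E0E2_E3E5`);
* `E0↔E3, E2↔E5`: both sides `0`;
* `E0↔E5, E2↔E3`: `u₁(θ₁)·u₂(θ₂)·w₂(δ) + u₂(δ)·v(θ₁)·v(θ₂) = u₂(δ)·w₁(θ₁)·w₂(θ₂)` (`yangBaxter_E0E5_E2E3`);
* `E0↔E2, E4↔E5`: both sides `u₁(δ)·u₁(θ₁)·u₁(θ₂) + v(δ)·v(θ₁)·w₁(θ₂)`;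
* `E0↔E4, E2↔E5`: both sides `v(δ)·v(θ₁)·w₂(θ₂)`;
* `E0↔E5, E2↔E4`: both sides `0`;
* `E0↔E3, E4↔E5`: `u₁(δ)·v(θ₁)·w₁(θ₂) + u₁(θ₁)·u₁(θ₂)·v(δ) = u₁(δ)·v(θ₂)·w₁(θ₁)` (`yangBaxter_E0E3_E4E5`);
* `E0↔E4, E3↔E5`: `u₁(δ)·v(θ₁)·w₂(θ₂) = u₁(δ)·v(θ₂)·w₂(θ₁) + u₂(θ₁)·u₂(θ₂)·v(δ)` (`yangBaxter_E0E4_E3E5`);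
* `E0↔E5, E3↔E4`: both sides `0`;
* `E1↔E2, E3↔E4`: both sides `v(θ₁)·v(θ₂)·w₁(δ)`;
* `E1↔E3, E2↔E4`: both sides `0`;
* `E1↔E4, E2↔E3`: both sides `u₁(θ₁)·u₂(δ)·u₂(θ₂) + v(θ₁)·v(θ₂)·w₂(δ)`;
* `E1↔E2, E3↔E5`: `u₂(θ₂)·v(θ₁)·w₁(δ) = u₁(δ)·u₂(θ₁)·v(θ₂) + u₂(θ₂)·v(δ)·w₂(θ₁)` (`yangBaxter_E1E2_E3E5`);
* `E1↔E3, E2↔E5`: both sides `0`;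
* `E1↔E5, E2↔E3`: `u₁(θ₁)·u₂(δ)·v(θ₂) + u₂(θ₂)·v(θ₁)·w₂(δ) = u₂(θ₂)·v(δ)·w₁(θ₁)` (`yangBaxter_E1E5_E2E3`);
* `E1↔E2, E4↔E5`: `u₁(δ)·u₁(θ₂)·v(θ₁) + u₁(θ₁)·v(δ)·w₁(θ₂) = u₁(θ₁)·v(θ₂)·w₁(δ)` (`yangBaxter_E1E2_E4E5`);
* `E1↔E4, E2↔E5`: `u₁(θ₁)·v(δ)·w₂(θ₂) = u₁(θ₁)·v(θ₂)·w₂(δ) + u₂(δ)·u₂(θ₂)·v(θ₁)` (`yangBaxter_E1E4_E2E5`);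
* `E1↔E5, E2↔E4`: both sides `0`;
* `E1↔E3, E4↔E5`: `u₁(δ)·u₁(θ₁)·w₁(θ₂) + u₁(θ₂)·v(δ)·v(θ₁) = u₁(θ₂)·w₁(δ)·w₁(θ₁)` (`yangBaxter_E1E3_E4E5`);
* `E1↔E4, E3↔E5`: `u₁(δ)·u₁(θ₁)·w₂(θ₂) = u₁(θ₂)·w₁(δ)·w₂(θ₁) + u₁(θ₂)·w₁(θ₁)·w₂(δ) + u₂(δ)·u₂(θ₁)` (`yangBaxter_E1E4_E3E5`);
* `E1↔E5, E3↔E4`: both sides `0`;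
* `E2↔E3, E4↔E5`: `u₁(θ₂)·u₂(δ) + u₂(θ₁)·w₁(δ)·w₁(θ₂) + u₂(θ₁)·w₂(δ)·w₂(θ₂) = u₁(δ)·u₂(θ₂)·w₁(θ₁)` (`yangBaxter_E2E3_E4E5`);
* `E2↔E4, E3↔E5`: `u₂(θ₁)·w₁(δ)·w₂(θ₂) = u₁(δ)·u₂(θ₂)·w₂(θ₁) + u₂(θ₁)·v(δ)·v(θ₂)` (`yangBaxter_E2E4_E3E5`);
* `E2↔E5, E3↔E4`: both sides `0`;
* `E0↔E1, E2↔E3, E4↔E5`: `u₁(θ₂)·u₂(δ)·u₂(θ₁) + w₁(δ)·w₁(θ₂)·w₂(θ₁) + w₁(θ₁)·w₁(θ₂)·w₂(δ) + w₂(δ)·w₂(θ₁)·w₂(θ₂) = w₁(δ)·w₁(θ₁)·w₂(θ₂)` (`yangBaxter_E0E1_E2E3_E4E5`);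
* `E0↔E1, E2↔E4, E3↔E5`: both sides `w₁(δ)·w₂(θ₁)·w₂(θ₂)`;
* `E0↔E1, E2↔E5, E3↔E4`: both sides `0`;
* `E0↔E2, E1↔E3, E4↔E5`: both sides `w₁(δ)·w₁(θ₁)·w₁(θ₂)`;
* `E0↔E2, E1↔E4, E3↔E5`: `w₁(δ)·w₁(θ₁)·w₂(θ₂) = u₁(θ₂)·u₂(δ)·u₂(θ₁) + w₁(δ)·w₁(θ₂)·w₂(θ₁) + w₁(θ₁)·w₁(θ₂)·w₂(δ) + w₂(δ)·w₂(θ₁)·w₂(θ₂)` (`yangBaxter_E0E2_E1E4_E3E5`);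
* `E0↔E2, E1↔E5, E3↔E4`: both sides `0`;
* `E0↔E3, E1↔E2, E4↔E5`: both sides `0`;
* `E0↔E3, E1↔E4, E2↔E5`: both sides `0`;
* `E0↔E3, E1↔E5, E2↔E4`: both sides `0`;
* `E0↔E4, E1↔E2, E3↔E5`: both sides `0`;
* `E0↔E4, E1↔E3, E2↔E5`: both sides `0`;
* `E0↔E4, E1↔E5, E2↔E3`: both sides `0`;
* `E0↔E5, E1↔E2, E3↔E4`: both sides `0`;
* `E0↔E5, E1↔E3, E2↔E4`: both sides `0`;
* `E0↔E5, E1↔E4, E2↔E3`: both sides `w₁(θ₁)·w₂(δ)·w₂(θ₂)`.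

## Method

With `ζ = e^{iπ/8}` (`ζ⁸ = −1`) and `E(z) = e^{3iz/8}`, every factor of eq. (1) is a Laurent monomial
expression: `sin(5π/4 + 3z/8) = ζ²(ζ⁴E² − 1)/(2E)`, `sin(5π/8 − 3z/8) = (E² + ζ²)/(2ζE)`,
`sin(5π/4) = −(ζ⁴ + 1)/(2ζ²)`, `sin(5π/8 + 3z/8) = (1 + ζ²E²)/(2ζE)`, `sin(3z/8) = (1 − E²)ζ⁴/(2E)`,
`sin(5π/4 − 3z/8) = (ζ⁴ − E²)ζ²/(2E)`, `sin(15π/8 + 3z/8) = −(1 + ζ⁶E²)/(2ζ³E)` (`sin_shape1` …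
`sin_shape8`, valid for complex `z`), and `E(θ₂ − θ₁) = E(θ₂)/E(θ₁)`. Each identity, cast to `ℂ`,
thus becomes a rational identity in `ζ, E(θ₁), E(θ₂)`; `field_simp` clears the denominators (the
factors of `weightDen`, non-zero by hypothesis — `weightDen θ < 0` on `(0, π)`,
`weightDen_neg_of_mem_Ioo`, covers `θ₁, θ₂ ∈ [π/3, 2π/3]` and `δ ∈ (0, π/3]`) and the resulting
polynomial identity holds in `ℚ[ζ, E₁, E₂]/(ζ⁸ + 1)`: `ring_nf`, reduction of the powers `ζⁿ`,
`n ≥ 8`, by `ζⁿ = −ζⁿ⁻⁸`, `ring_nf`. No certificates are needed. References for the equations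
themselves: [N90] = B. Nienhuis, Int. J. Mod. Phys. B 4 (1990); [AB] = I. Alam, M. Batchelor,
J. Phys. A 47 (2014) ("where the Yang–Baxter equations are explicitly listed"); [Gl] = A. Glazman,
ECP 20 (2015) (general loop weight).
-/

noncomputable section

open Real

namespace Literature.Probability.RandomPlanarGeometry.SAW.YangBaxter

open _root_.Complex

/-! ### Exponential form of the factors of eq. (1) -/

/-- `ζ = e^{iπ/8}` is non-zero. [folklore] -/
theorem exp_pi_div_eight_ne_zero : cexp (↑π / 8 * I) ≠ 0 := exp_ne_zero _

/-- `ζ^k = e^{ikπ/8}`. [folklore] -/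
theorem exp_pi_div_eight_pow (k : ℕ) : cexp (↑π / 8 * I) ^ k = cexp ((k : ℂ) * π / 8 * I) := by
  rw [← Complex.exp_nat_mul]
  congr 1
  ring

/-- `ζ⁸ = −1`. [folklore] -/
theorem exp_pi_div_eight_pow_eight : cexp (↑π / 8 * I) ^ 8 = -1 := by
  rw [exp_pi_div_eight_pow]
  have : ((8 : ℕ) : ℂ) * π / 8 * I = π * I := by push_cast; ring
  rw [this, Complex.exp_pi_mul_I]

/-- `ζ⁴ = i`. [folklore] -/
theorem exp_pi_div_eight_pow_four : cexp (↑π / 8 * I) ^ 4 = I := by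
  rw [exp_pi_div_eight_pow]
  have : ((4 : ℕ) : ℂ) * π / 8 * I = (π / 2 : ℂ) * I := by push_cast; ring
  rw [this, ← Complex.ofReal_ofNat, ← Complex.ofReal_div, Complex.exp_mul_I, ← Complex.ofReal_cos,
    ← Complex.ofReal_sin, Real.cos_pi_div_two, Real.sin_pi_div_two]
  simp

/-- Reduction of the powers of `ζ` modulo `ζ⁸ = −1`, as a conditional rewrite rule (the side
condition `8 ≤ n` is decided on the literal exponents produced by `ring_nf`). [folklore] -/
theorem exp_pi_div_eight_pow_red (n : ℕ) (h : 8 ≤ n) :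
    cexp (↑π / 8 * I) ^ n = -cexp (↑π / 8 * I) ^ (n - 8) := by
  obtain ⟨k, rfl⟩ := Nat.exists_eq_add_of_le h
  rw [pow_add, exp_pi_div_eight_pow_eight, Nat.add_sub_cancel_left]
  ring

/-- `E(a − b) = E(a)/E(b)`. [folklore] -/
theorem exp_three_mul_sub_div_eight (a b : ℂ) :
    cexp (3 * (a - b) / 8 * I) = cexp (3 * a / 8 * I) / cexp (3 * b / 8 * I) := by
  rw [← Complex.exp_sub]
  congr 1
  ring

/-- `sin w = (1 − e^{2iw}) i / (2e^{iw})`. [folklore] -/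
theorem sin_eq_of_exp (w : ℂ) : Complex.sin w = (1 - cexp (w * I) ^ 2) * I / (2 * cexp (w * I)) := by
  have hE : cexp (w * I) ≠ 0 := exp_ne_zero _
  rw [Complex.sin]
  have hneg : cexp (-w * I) = (cexp (w * I))⁻¹ := by
    rw [← Complex.exp_neg]; congr 1; ring
  rw [hneg]
  field_simp

/-- Shape 1: `sin(5π/4 + 3z/8) = ζ²(ζ⁴E² − 1)/(2E)`. [folklore] -/
theorem sin_shape1 (z : ℂ) : Complex.sin (5 * π / 4 + 3 * z / 8) =
    cexp (↑π / 8 * I) ^ 2 * (cexp (↑π / 8 * I) ^ 4 * cexp (3 * z / 8 * I) ^ 2 - 1) /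
      (2 * cexp (3 * z / 8 * I)) := by
  have hE : cexp ((5 * π / 4 + 3 * z / 8) * I) = cexp (↑π / 8 * I) ^ 10 * cexp (3 * z / 8 * I) := by
    rw [add_mul, Complex.exp_add, exp_pi_div_eight_pow]
    congr 2; push_cast; ring
  rw [sin_eq_of_exp, hE]
  set ζ := cexp (↑π / 8 * I) with hζ
  set E := cexp (3 * z / 8 * I) with hEdef
  have h8 : ζ ^ 8 = -1 := exp_pi_div_eight_pow_eight
  have h4 : ζ ^ 4 = I := exp_pi_div_eight_pow_four
  have hz : ζ ≠ 0 := exp_pi_div_eight_ne_zero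
  have hX : E ≠ 0 := exp_ne_zero _
  rw [← h4]
  have hred : ∀ n : ℕ, 8 ≤ n → ζ ^ n = -ζ ^ (n - 8) := exp_pi_div_eight_pow_red
  field_simp
  ring_nf
  simp (disch := decide) only [hred]
  ring_nf

/-- Shape 2: `sin(5π/8 − 3z/8) = (E² + ζ²)/(2ζE)`. [folklore] -/
theorem sin_shape2 (z : ℂ) : Complex.sin (5 * π / 8 - 3 * z / 8) =
    (cexp (3 * z / 8 * I) ^ 2 + cexp (↑π / 8 * I) ^ 2) / (2 * cexp (↑π / 8 * I) * cexp (3 * z / 8 * I)) := by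
  have hE : cexp ((5 * π / 8 - 3 * z / 8) * I) = cexp (↑π / 8 * I) ^ 5 / cexp (3 * z / 8 * I) := by
    rw [sub_mul, Complex.exp_sub, exp_pi_div_eight_pow]
    congr 2
  rw [sin_eq_of_exp, hE]
  set ζ := cexp (↑π / 8 * I) with hζ
  set E := cexp (3 * z / 8 * I) with hEdef
  have h8 : ζ ^ 8 = -1 := exp_pi_div_eight_pow_eight
  have h4 : ζ ^ 4 = I := exp_pi_div_eight_pow_four
  have hz : ζ ≠ 0 := exp_pi_div_eight_ne_zero
  have hX : E ≠ 0 := exp_ne_zero _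
  rw [← h4]
  have hred : ∀ n : ℕ, 8 ≤ n → ζ ^ n = -ζ ^ (n - 8) := exp_pi_div_eight_pow_red
  field_simp
  ring_nf
  simp (disch := decide) only [hred]
  ring_nf

/-- Shape 3: `sin(5π/4) = −(ζ⁴ + 1)/(2ζ²)` (`= −√2/2`). [folklore] -/
theorem sin_shape3 : Complex.sin (5 * π / 4) = -(cexp (↑π / 8 * I) ^ 4 + 1) / (2 * cexp (↑π / 8 * I) ^ 2) := by
  have hE : cexp ((5 * π / 4) * I) = cexp (↑π / 8 * I) ^ 10 := by
    rw [exp_pi_div_eight_pow]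
    congr 1; push_cast; ring
  rw [sin_eq_of_exp, hE]
  set ζ := cexp (↑π / 8 * I) with hζ
  have h8 : ζ ^ 8 = -1 := exp_pi_div_eight_pow_eight
  have h4 : ζ ^ 4 = I := exp_pi_div_eight_pow_four
  have hz : ζ ≠ 0 := exp_pi_div_eight_ne_zero
  rw [← h4]
  have hred : ∀ n : ℕ, 8 ≤ n → ζ ^ n = -ζ ^ (n - 8) := exp_pi_div_eight_pow_red
  field_simp
  ring_nf
  simp (disch := decide) only [hred]
  ring_nf

/-- Shape 4: `sin(5π/8 + 3z/8) = (1 + ζ²E²)/(2ζE)`. [folklore] -/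
theorem sin_shape4 (z : ℂ) : Complex.sin (5 * π / 8 + 3 * z / 8) =
    (1 + cexp (↑π / 8 * I) ^ 2 * cexp (3 * z / 8 * I) ^ 2) / (2 * cexp (↑π / 8 * I) * cexp (3 * z / 8 * I)) := by
  have hE : cexp ((5 * π / 8 + 3 * z / 8) * I) = cexp (↑π / 8 * I) ^ 5 * cexp (3 * z / 8 * I) := by
    rw [add_mul, Complex.exp_add, exp_pi_div_eight_pow]
    congr 2
  rw [sin_eq_of_exp, hE]
  set ζ := cexp (↑π / 8 * I) with hζ
  set E := cexp (3 * z / 8 * I) with hEdef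
  have h8 : ζ ^ 8 = -1 := exp_pi_div_eight_pow_eight
  have h4 : ζ ^ 4 = I := exp_pi_div_eight_pow_four
  have hz : ζ ≠ 0 := exp_pi_div_eight_ne_zero
  have hX : E ≠ 0 := exp_ne_zero _
  rw [← h4]
  have hred : ∀ n : ℕ, 8 ≤ n → ζ ^ n = -ζ ^ (n - 8) := exp_pi_div_eight_pow_red
  field_simp
  ring_nf
  simp (disch := decide) only [hred]
  ring_nf

/-- Shape 5: `sin(3z/8) = (1 − E²)ζ⁴/(2E)`. [folklore] -/
theorem sin_shape5 (z : ℂ) : Complex.sin (3 * z / 8) =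
    (1 - cexp (3 * z / 8 * I) ^ 2) * cexp (↑π / 8 * I) ^ 4 / (2 * cexp (3 * z / 8 * I)) := by
  rw [sin_eq_of_exp, exp_pi_div_eight_pow_four]

/-- Shape 6: `sin(−(3z/8)) = (E² − 1)ζ⁴/(2E)`. [folklore] -/
theorem sin_shape6 (z : ℂ) : Complex.sin (-(3 * z / 8)) =
    (cexp (3 * z / 8 * I) ^ 2 - 1) * cexp (↑π / 8 * I) ^ 4 / (2 * cexp (3 * z / 8 * I)) := by
  rw [Complex.sin_neg, sin_shape5]
  ring

/-- Shape 7: `sin(5π/4 − 3z/8) = (ζ⁴ − E²)ζ²/(2E)`. [folklore] -/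
theorem sin_shape7 (z : ℂ) : Complex.sin (5 * π / 4 - 3 * z / 8) =
    (cexp (↑π / 8 * I) ^ 4 - cexp (3 * z / 8 * I) ^ 2) * cexp (↑π / 8 * I) ^ 2 / (2 * cexp (3 * z / 8 * I)) := by
  have hE : cexp ((5 * π / 4 - 3 * z / 8) * I) = cexp (↑π / 8 * I) ^ 10 / cexp (3 * z / 8 * I) := by
    rw [sub_mul, Complex.exp_sub, exp_pi_div_eight_pow]
    congr 2; push_cast; ring
  rw [sin_eq_of_exp, hE]
  set ζ := cexp (↑π / 8 * I) with hζ
  set E := cexp (3 * z / 8 * I) with hEdef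
  have h8 : ζ ^ 8 = -1 := exp_pi_div_eight_pow_eight
  have h4 : ζ ^ 4 = I := exp_pi_div_eight_pow_four
  have hz : ζ ≠ 0 := exp_pi_div_eight_ne_zero
  have hX : E ≠ 0 := exp_ne_zero _
  rw [← h4]
  have hred : ∀ n : ℕ, 8 ≤ n → ζ ^ n = -ζ ^ (n - 8) := exp_pi_div_eight_pow_red
  field_simp
  ring_nf
  simp (disch := decide) only [hred]
  ring_nf

/-- Shape 8: `sin(15π/8 + 3z/8) = −(1 + ζ⁶E²)/(2ζ³E)`. [folklore] -/
theorem sin_shape8 (z : ℂ) : Complex.sin (15 * π / 8 + 3 * z / 8) =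
    -(1 + cexp (↑π / 8 * I) ^ 6 * cexp (3 * z / 8 * I) ^ 2) / (2 * cexp (↑π / 8 * I) ^ 3 * cexp (3 * z / 8 * I)) := by
  have hE : cexp ((15 * π / 8 + 3 * z / 8) * I) = cexp (↑π / 8 * I) ^ 15 * cexp (3 * z / 8 * I) := by
    rw [add_mul, Complex.exp_add, exp_pi_div_eight_pow]
    congr 2
  rw [sin_eq_of_exp, hE]
  set ζ := cexp (↑π / 8 * I) with hζ
  set E := cexp (3 * z / 8 * I) with hEdef
  have h8 : ζ ^ 8 = -1 := exp_pi_div_eight_pow_eight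
  have h4 : ζ ^ 4 = I := exp_pi_div_eight_pow_four
  have hz : ζ ≠ 0 := exp_pi_div_eight_ne_zero
  have hX : E ≠ 0 := exp_ne_zero _
  rw [← h4]
  have hred : ∀ n : ℕ, 8 ≤ n → ζ ^ n = -ζ ^ (n - 8) := exp_pi_div_eight_pow_red
  field_simp
  ring_nf
  simp (disch := decide) only [hred]
  ring_nf

/-! ### Non-vanishing of the denominators -/

/-- The common denominator of eq. (1) is negative for every angle `θ ∈ (0, π)`:
`5π/4 + 3θ/8 ∈ (π, 2π)` and `5π/8 − 3θ/8 ∈ (0, π)`. This covers the column angles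
`θ ∈ [π/3, 2π/3]` as well as the angle `θ₂ − θ₁ ∈ (0, π/3]` of the added rhombus of Proposition 4.2.
[cite: GlazmanManolescu2019, §1 (eq. (1)) and §3 ("rhombi with any angles in (0, π)")] -/
theorem weightDen_neg_of_mem_Ioo {θ : ℝ} (hθ : θ ∈ Set.Ioo 0 π) : weightDen θ < 0 := by
  obtain ⟨h0, hπ⟩ := hθ
  unfold weightDen
  apply mul_neg_of_neg_of_pos
  · rw [← Real.sin_sub_two_pi]
    apply Real.sin_neg_of_neg_of_neg_pi_lt <;> linarith
  · apply Real.sin_pos_of_pos_of_lt_pi <;> linarith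

/-- Non-vanishing of the common denominator on `(0, π)`. [cite: GlazmanManolescu2019, eq. (1)] -/
theorem weightDen_ne_zero_of_mem_Ioo {θ : ℝ} (hθ : θ ∈ Set.Ioo 0 π) : weightDen θ ≠ 0 :=
  (weightDen_neg_of_mem_Ioo hθ).ne

/-- The two factors of a non-vanishing denominator `weightDen θ`, in exponential form. [folklore] -/
theorem den_ne_zero_complex {θ : ℝ} (h : weightDen θ ≠ 0) :
    cexp (↑π / 8 * I) ^ 4 * cexp (3 * (θ : ℂ) / 8 * I) ^ 2 - 1 ≠ 0 ∧
      cexp (3 * (θ : ℂ) / 8 * I) ^ 2 + cexp (↑π / 8 * I) ^ 2 ≠ 0 := by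
  unfold weightDen at h
  obtain ⟨h1, h2⟩ := mul_ne_zero_iff.mp h
  have h1' : (Real.sin (5 * π / 4 + 3 * θ / 8) : ℂ) ≠ 0 := Complex.ofReal_ne_zero.mpr h1
  have h2' : (Real.sin (5 * π / 8 - 3 * θ / 8) : ℂ) ≠ 0 := Complex.ofReal_ne_zero.mpr h2
  push_cast at h1' h2'
  rw [sin_shape1] at h1'
  rw [sin_shape2] at h2'
  constructor
  · intro h0; apply h1'; rw [h0]; simp
  · intro h0; apply h2'; rw [h0]; simp

/-- The same for a difference of angles, denominators cleared. [folklore] -/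
theorem den_sub_ne_zero_complex {θ₁ θ₂ : ℝ} (h : weightDen (θ₂ - θ₁) ≠ 0) :
    cexp (↑π / 8 * I) ^ 4 * cexp (3 * (θ₂ : ℂ) / 8 * I) ^ 2 - cexp (3 * (θ₁ : ℂ) / 8 * I) ^ 2 ≠ 0 ∧
      cexp (3 * (θ₂ : ℂ) / 8 * I) ^ 2 + cexp (↑π / 8 * I) ^ 2 * cexp (3 * (θ₁ : ℂ) / 8 * I) ^ 2 ≠ 0 := by
  obtain ⟨h1, h2⟩ := den_ne_zero_complex h
  push_cast at h1 h2
  rw [exp_three_mul_sub_div_eight] at h1 h2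
  set ζ := cexp (↑π / 8 * I) with hζ
  set E₁ := cexp (3 * (θ₁ : ℂ) / 8 * I) with hE₁
  set E₂ := cexp (3 * (θ₂ : ℂ) / 8 * I) with hE₂
  have hXi : E₁ ≠ 0 := exp_ne_zero _
  constructor
  · intro h0; apply h1
    field_simp
    linear_combination h0
  · intro h0; apply h2
    field_simp
    linear_combination h0

/-! ### The symmetry `θ ↦ π − θ` and the signs of the single-arc weights -/

/-- `weightDen (π − θ) = weightDen θ`. [cite: GlazmanManolescu2019, §1 ("replacing θ by π − θ
exchanges u₁ with u₂ and w₁ with w₂, but does not affect v")] -/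
theorem weightDen_pi_sub (θ : ℝ) : weightDen (π - θ) = weightDen θ := by
  unfold weightDen
  have h1 : 5 * π / 4 + 3 * (π - θ) / 8 = (5 * π / 8 - 3 * θ / 8) + π := by ring
  have h2 : 5 * π / 8 - 3 * (π - θ) / 8 = (5 * π / 4 + 3 * θ / 8) - π := by ring
  rw [h1, h2, Real.sin_add_pi, Real.sin_sub_pi]
  ring

/-- `u₁(π − θ) = u₂(θ)`: "replacing `θ` by `π − θ` exchanges `u₁` with `u₂`".
[cite: GlazmanManolescu2019, §1 (after eq. (1))] -/
theorem weightU1_pi_sub (θ : ℝ) : weightU1 (π - θ) = weightU2 θ := by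
  unfold weightU1 weightU2
  rw [weightDen_pi_sub]
  have h : 5 * π / 8 + 3 * (π - θ) / 8 = π - 3 * θ / 8 := by ring
  rw [h, Real.sin_pi_sub]

/-- `u₂(π − θ) = u₁(θ)`. [cite: GlazmanManolescu2019, §1 (after eq. (1))] -/
theorem weightU2_pi_sub (θ : ℝ) : weightU2 (π - θ) = weightU1 θ := by
  unfold weightU1 weightU2
  rw [weightDen_pi_sub]
  have h : 3 * (π - θ) / 8 = π - (5 * π / 8 + 3 * θ / 8) := by ring
  rw [h, Real.sin_pi_sub]

/-- `v(π − θ) = v(θ)`: "… but does not affect `v`". [cite: GlazmanManolescu2019, §1 (after eq. (1))] -/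
theorem weightV_pi_sub (θ : ℝ) : weightV (π - θ) = weightV θ := by
  unfold weightV
  rw [weightDen_pi_sub]
  have h1 : 5 * π / 8 + 3 * (π - θ) / 8 = π - 3 * θ / 8 := by ring
  have h2 : -(3 * (π - θ) / 8) = (5 * π / 8 + 3 * θ / 8) - π := by ring
  rw [h1, h2, Real.sin_pi_sub, Real.sin_sub_pi, Real.sin_neg]
  ring

/-- `w₁(π − θ) = w₂(θ)`: "replacing `θ` by `π − θ` exchanges … `w₁` with `w₂`".
[cite: GlazmanManolescu2019, §1 (after eq. (1))] -/
theorem weightW1_pi_sub (θ : ℝ) : weightW1 (π - θ) = weightW2 θ := by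
  unfold weightW1 weightW2
  rw [weightDen_pi_sub]
  have h1 : 5 * π / 8 + 3 * (π - θ) / 8 = π - 3 * θ / 8 := by ring
  have h2 : 5 * π / 4 - 3 * (π - θ) / 8 = (15 * π / 8 + 3 * θ / 8) - π := by ring
  rw [h1, h2, Real.sin_pi_sub, Real.sin_sub_pi, Real.sin_neg]
  ring

/-- `w₂(π − θ) = w₁(θ)`. [cite: GlazmanManolescu2019, §1 (after eq. (1))] -/
theorem weightW2_pi_sub (θ : ℝ) : weightW2 (π - θ) = weightW1 θ := by
  unfold weightW1 weightW2
  rw [weightDen_pi_sub]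
  have h1 : 15 * π / 8 + 3 * (π - θ) / 8 = (5 * π / 4 - 3 * θ / 8) - π + 2 * π := by ring
  have h2 : -(3 * (π - θ) / 8) = (5 * π / 8 + 3 * θ / 8) - π := by ring
  rw [h1, h2, Real.sin_add_two_pi, Real.sin_sub_pi, Real.sin_sub_pi]
  ring

/-- `u₁(θ) > 0` for every `θ ∈ (0, π)` ("A path `γ` contributing to the above traverses `r` only as
one arc, hence always has positive weight", proof of Proposition 4.2).
[cite: GlazmanManolescu2019, Proposition 4.2 (proof)] -/
theorem weightU1_pos_of_mem_Ioo {θ : ℝ} (hθ : θ ∈ Set.Ioo 0 π) : 0 < weightU1 θ := by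
  have hden := weightDen_neg_of_mem_Ioo hθ
  obtain ⟨h0, hπ⟩ := hθ
  have h5 : Real.sin (5 * π / 4) < 0 := by
    rw [show 5 * π / 4 = π / 4 + π by ring, Real.sin_add_pi, neg_lt_zero, Real.sin_pi_div_four]
    positivity
  unfold weightU1
  apply div_pos_of_neg_of_neg _ hden
  apply mul_neg_of_neg_of_pos h5
  apply Real.sin_pos_of_pos_of_lt_pi <;> linarith

/-- `u₂(θ) > 0` for every `θ ∈ (0, π)` (the weight of the single arc of a walk through the added
rhombus `r` of Proposition 4.2, around its bottom or top vertex).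
[cite: GlazmanManolescu2019, Proposition 4.2 (proof)] -/
theorem weightU2_pos_of_mem_Ioo {θ : ℝ} (hθ : θ ∈ Set.Ioo 0 π) : 0 < weightU2 θ := by
  have hden := weightDen_neg_of_mem_Ioo hθ
  obtain ⟨h0, hπ⟩ := hθ
  have h5 : Real.sin (5 * π / 4) < 0 := by
    rw [show 5 * π / 4 = π / 4 + π by ring, Real.sin_add_pi, neg_lt_zero, Real.sin_pi_div_four]
    positivity
  unfold weightU2
  apply div_pos_of_neg_of_neg _ hden
  apply mul_neg_of_neg_of_pos h5
  apply Real.sin_pos_of_pos_of_lt_pi <;> linarith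

/-- `v(θ) > 0` for every `θ ∈ (0, π)`. [cite: GlazmanManolescu2019, Proposition 4.2 (proof)] -/
theorem weightV_pos_of_mem_Ioo {θ : ℝ} (hθ : θ ∈ Set.Ioo 0 π) : 0 < weightV θ := by
  have hden := weightDen_neg_of_mem_Ioo hθ
  obtain ⟨h0, hπ⟩ := hθ
  unfold weightV
  apply div_pos_of_neg_of_neg _ hden
  apply mul_neg_of_pos_of_neg
  · apply Real.sin_pos_of_pos_of_lt_pi <;> linarith
  · rw [Real.sin_neg, neg_lt_zero]
    apply Real.sin_pos_of_pos_of_lt_pi <;> linarith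

/-! ### The Yang–Baxter identities -/

/-- **Yang–Baxter equation, pairing `E0 ↔ E1`** (`k = 1`): in `𝖧` the families realising it weigh
`u₁(θ₂)·u₂(δ)·w₁(θ₁) + u₂(θ₁)`, in `𝖧'` they weigh `u₁(δ)·u₂(θ₂) + u₂(θ₁)·v(δ)·v(θ₂)`.
[cite: GlazmanManolescu2019, Proposition 3.1] -/
theorem yangBaxter_E0E1 (θ₁ θ₂ : ℝ) (h₁ : weightDen θ₁ ≠ 0) (h₂ : weightDen θ₂ ≠ 0)
    (h₃ : weightDen (θ₂ - θ₁) ≠ 0) :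
    weightU1 θ₂ * weightU2 (θ₂ - θ₁) * weightW1 θ₁ + weightU2 θ₁ =
      weightU1 (θ₂ - θ₁) * weightU2 θ₂ + weightU2 θ₁ * weightV (θ₂ - θ₁) * weightV θ₂ := by
  obtain ⟨_hi1, _hi2⟩ := den_ne_zero_complex h₁
  obtain ⟨_hj1, _hj2⟩ := den_ne_zero_complex h₂
  obtain ⟨_hd1, _hd2⟩ := den_sub_ne_zero_complex h₃
  obtain ⟨_hd3, _hd4⟩ := den_ne_zero_complex h₃
  push_cast at _hd3 _hd4
  rw [exp_three_mul_sub_div_eight] at _hd3 _hd4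
  apply Complex.ofReal_injective
  push_cast [weightU1, weightU2, weightV, weightW1, weightDen]
  simp only [sin_shape1, sin_shape2, sin_shape3, sin_shape4, sin_shape5, sin_shape6, sin_shape7, exp_three_mul_sub_div_eight]
  set ζ := cexp (↑π / 8 * I) with _hζ
  set E₁ := cexp (3 * (θ₁ : ℂ) / 8 * I) with _hE₁
  set E₂ := cexp (3 * (θ₂ : ℂ) / 8 * I) with _hE₂
  have _hz : ζ ≠ 0 := exp_pi_div_eight_ne_zero
  have _hX₁ : E₁ ≠ 0 := exp_ne_zero _
  have _hX₂ : E₂ ≠ 0 := exp_ne_zero _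
  have hred : ∀ n : ℕ, 8 ≤ n → ζ ^ n = -ζ ^ (n - 8) := exp_pi_div_eight_pow_red
  field_simp
  ring_nf
  simp (disch := decide) only [hred]
  ring_nf

/-- **Yang–Baxter equation, pairing `E0 ↔ E2`** (`k = 1`): in `𝖧` the families realising it weigh
`u₁(δ)·u₁(θ₁) + u₁(θ₂)·v(δ)·v(θ₁)`, in `𝖧'` they weigh `u₁(θ₂) + u₂(δ)·u₂(θ₁)·w₂(θ₂)`.
[cite: GlazmanManolescu2019, Proposition 3.1] -/
theorem yangBaxter_E0E2 (θ₁ θ₂ : ℝ) (h₁ : weightDen θ₁ ≠ 0) (h₂ : weightDen θ₂ ≠ 0)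
    (h₃ : weightDen (θ₂ - θ₁) ≠ 0) :
    weightU1 (θ₂ - θ₁) * weightU1 θ₁ + weightU1 θ₂ * weightV (θ₂ - θ₁) * weightV θ₁ =
      weightU1 θ₂ + weightU2 (θ₂ - θ₁) * weightU2 θ₁ * weightW2 θ₂ := by
  obtain ⟨_hi1, _hi2⟩ := den_ne_zero_complex h₁
  obtain ⟨_hj1, _hj2⟩ := den_ne_zero_complex h₂
  obtain ⟨_hd1, _hd2⟩ := den_sub_ne_zero_complex h₃
  obtain ⟨_hd3, _hd4⟩ := den_ne_zero_complex h₃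
  push_cast at _hd3 _hd4
  rw [exp_three_mul_sub_div_eight] at _hd3 _hd4
  apply Complex.ofReal_injective
  push_cast [weightU1, weightU2, weightV, weightW2, weightDen]
  simp only [sin_shape1, sin_shape2, sin_shape3, sin_shape4, sin_shape5, sin_shape6, sin_shape8, exp_three_mul_sub_div_eight]
  set ζ := cexp (↑π / 8 * I) with _hζ
  set E₁ := cexp (3 * (θ₁ : ℂ) / 8 * I) with _hE₁
  set E₂ := cexp (3 * (θ₂ : ℂ) / 8 * I) with _hE₂
  have _hz : ζ ≠ 0 := exp_pi_div_eight_ne_zero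
  have _hX₁ : E₁ ≠ 0 := exp_ne_zero _
  have _hX₂ : E₂ ≠ 0 := exp_ne_zero _
  have hred : ∀ n : ℕ, 8 ≤ n → ζ ^ n = -ζ ^ (n - 8) := exp_pi_div_eight_pow_red
  field_simp
  ring_nf
  simp (disch := decide) only [hred]
  ring_nf

/-- **Yang–Baxter equation, pairing `E0 ↔ E3`** (`k = 1`): in `𝖧` the families realising it weigh
`u₁(δ)·u₁(θ₂)·v(θ₁) + u₁(θ₁)·v(δ)`, in `𝖧'` they weigh `u₁(θ₁)·v(θ₂) + u₂(δ)·u₂(θ₂)·v(θ₁)`.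
[cite: GlazmanManolescu2019, Proposition 3.1] -/
theorem yangBaxter_E0E3 (θ₁ θ₂ : ℝ) (h₁ : weightDen θ₁ ≠ 0) (h₂ : weightDen θ₂ ≠ 0)
    (h₃ : weightDen (θ₂ - θ₁) ≠ 0) :
    weightU1 (θ₂ - θ₁) * weightU1 θ₂ * weightV θ₁ + weightU1 θ₁ * weightV (θ₂ - θ₁) =
      weightU1 θ₁ * weightV θ₂ + weightU2 (θ₂ - θ₁) * weightU2 θ₂ * weightV θ₁ := by
  obtain ⟨_hi1, _hi2⟩ := den_ne_zero_complex h₁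
  obtain ⟨_hj1, _hj2⟩ := den_ne_zero_complex h₂
  obtain ⟨_hd1, _hd2⟩ := den_sub_ne_zero_complex h₃
  obtain ⟨_hd3, _hd4⟩ := den_ne_zero_complex h₃
  push_cast at _hd3 _hd4
  rw [exp_three_mul_sub_div_eight] at _hd3 _hd4
  apply Complex.ofReal_injective
  push_cast [weightU1, weightU2, weightV, weightDen]
  simp only [sin_shape1, sin_shape2, sin_shape3, sin_shape4, sin_shape5, sin_shape6, exp_three_mul_sub_div_eight]
  set ζ := cexp (↑π / 8 * I) with _hζ
  set E₁ := cexp (3 * (θ₁ : ℂ) / 8 * I) with _hE₁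
  set E₂ := cexp (3 * (θ₂ : ℂ) / 8 * I) with _hE₂
  have _hz : ζ ≠ 0 := exp_pi_div_eight_ne_zero
  have _hX₁ : E₁ ≠ 0 := exp_ne_zero _
  have _hX₂ : E₂ ≠ 0 := exp_ne_zero _
  have hred : ∀ n : ℕ, 8 ≤ n → ζ ^ n = -ζ ^ (n - 8) := exp_pi_div_eight_pow_red
  field_simp
  ring_nf
  simp (disch := decide) only [hred]
  ring_nf

/-- **Yang–Baxter equation, pairing `E0 ↔ E4`** (`k = 1`): in `𝖧` the families realising it weigh
`u₁(θ₁)·u₂(δ)·v(θ₂) + u₂(θ₂)·v(θ₁)`, in `𝖧'` they weigh `u₁(δ)·u₂(θ₁)·v(θ₂) + u₂(θ₂)·v(δ)`.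
[cite: GlazmanManolescu2019, Proposition 3.1] -/
theorem yangBaxter_E0E4 (θ₁ θ₂ : ℝ) (h₁ : weightDen θ₁ ≠ 0) (h₂ : weightDen θ₂ ≠ 0)
    (h₃ : weightDen (θ₂ - θ₁) ≠ 0) :
    weightU1 θ₁ * weightU2 (θ₂ - θ₁) * weightV θ₂ + weightU2 θ₂ * weightV θ₁ =
      weightU1 (θ₂ - θ₁) * weightU2 θ₁ * weightV θ₂ + weightU2 θ₂ * weightV (θ₂ - θ₁) := by
  obtain ⟨_hi1, _hi2⟩ := den_ne_zero_complex h₁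
  obtain ⟨_hj1, _hj2⟩ := den_ne_zero_complex h₂
  obtain ⟨_hd1, _hd2⟩ := den_sub_ne_zero_complex h₃
  obtain ⟨_hd3, _hd4⟩ := den_ne_zero_complex h₃
  push_cast at _hd3 _hd4
  rw [exp_three_mul_sub_div_eight] at _hd3 _hd4
  apply Complex.ofReal_injective
  push_cast [weightU1, weightU2, weightV, weightDen]
  simp only [sin_shape1, sin_shape2, sin_shape3, sin_shape4, sin_shape5, sin_shape6, exp_three_mul_sub_div_eight]
  set ζ := cexp (↑π / 8 * I) with _hζ
  set E₁ := cexp (3 * (θ₁ : ℂ) / 8 * I) with _hE₁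
  set E₂ := cexp (3 * (θ₂ : ℂ) / 8 * I) with _hE₂
  have _hz : ζ ≠ 0 := exp_pi_div_eight_ne_zero
  have _hX₁ : E₁ ≠ 0 := exp_ne_zero _
  have _hX₂ : E₂ ≠ 0 := exp_ne_zero _
  have hred : ∀ n : ℕ, 8 ≤ n → ζ ^ n = -ζ ^ (n - 8) := exp_pi_div_eight_pow_red
  field_simp
  ring_nf
  simp (disch := decide) only [hred]
  ring_nf

/-- **Yang–Baxter equation, pairing `E1 ↔ E2`** (`k = 1`): in `𝖧` the families realising it weigh
`u₁(δ)·v(θ₁) + u₁(θ₁)·u₁(θ₂)·v(δ)`, in `𝖧'` they weigh `u₁(δ)·v(θ₂) + u₂(θ₁)·u₂(θ₂)·v(δ)`.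
[cite: GlazmanManolescu2019, Proposition 3.1] -/
theorem yangBaxter_E1E2 (θ₁ θ₂ : ℝ) (h₁ : weightDen θ₁ ≠ 0) (h₂ : weightDen θ₂ ≠ 0)
    (h₃ : weightDen (θ₂ - θ₁) ≠ 0) :
    weightU1 (θ₂ - θ₁) * weightV θ₁ + weightU1 θ₁ * weightU1 θ₂ * weightV (θ₂ - θ₁) =
      weightU1 (θ₂ - θ₁) * weightV θ₂ + weightU2 θ₁ * weightU2 θ₂ * weightV (θ₂ - θ₁) := by
  obtain ⟨_hi1, _hi2⟩ := den_ne_zero_complex h₁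
  obtain ⟨_hj1, _hj2⟩ := den_ne_zero_complex h₂
  obtain ⟨_hd1, _hd2⟩ := den_sub_ne_zero_complex h₃
  obtain ⟨_hd3, _hd4⟩ := den_ne_zero_complex h₃
  push_cast at _hd3 _hd4
  rw [exp_three_mul_sub_div_eight] at _hd3 _hd4
  apply Complex.ofReal_injective
  push_cast [weightU1, weightU2, weightV, weightDen]
  simp only [sin_shape1, sin_shape2, sin_shape3, sin_shape4, sin_shape5, sin_shape6, exp_three_mul_sub_div_eight]
  set ζ := cexp (↑π / 8 * I) with _hζ
  set E₁ := cexp (3 * (θ₁ : ℂ) / 8 * I) with _hE₁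
  set E₂ := cexp (3 * (θ₂ : ℂ) / 8 * I) with _hE₂
  have _hz : ζ ≠ 0 := exp_pi_div_eight_ne_zero
  have _hX₁ : E₁ ≠ 0 := exp_ne_zero _
  have _hX₂ : E₂ ≠ 0 := exp_ne_zero _
  have hred : ∀ n : ℕ, 8 ≤ n → ζ ^ n = -ζ ^ (n - 8) := exp_pi_div_eight_pow_red
  field_simp
  ring_nf
  simp (disch := decide) only [hred]
  ring_nf

/-- **Yang–Baxter equation, pairing `E1 ↔ E4`** (`k = 1`): in `𝖧` the families realising it weigh
`u₁(θ₁)·u₂(θ₂) + u₂(δ)·v(θ₁)·v(θ₂)`, in `𝖧'` they weigh `u₁(θ₂)·u₂(θ₁)·w₁(δ) + u₂(δ)`.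
[cite: GlazmanManolescu2019, Proposition 3.1] -/
theorem yangBaxter_E1E4 (θ₁ θ₂ : ℝ) (h₁ : weightDen θ₁ ≠ 0) (h₂ : weightDen θ₂ ≠ 0)
    (h₃ : weightDen (θ₂ - θ₁) ≠ 0) :
    weightU1 θ₁ * weightU2 θ₂ + weightU2 (θ₂ - θ₁) * weightV θ₁ * weightV θ₂ =
      weightU1 θ₂ * weightU2 θ₁ * weightW1 (θ₂ - θ₁) + weightU2 (θ₂ - θ₁) := by
  obtain ⟨_hi1, _hi2⟩ := den_ne_zero_complex h₁
  obtain ⟨_hj1, _hj2⟩ := den_ne_zero_complex h₂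
  obtain ⟨_hd1, _hd2⟩ := den_sub_ne_zero_complex h₃
  obtain ⟨_hd3, _hd4⟩ := den_ne_zero_complex h₃
  push_cast at _hd3 _hd4
  rw [exp_three_mul_sub_div_eight] at _hd3 _hd4
  apply Complex.ofReal_injective
  push_cast [weightU1, weightU2, weightV, weightW1, weightDen]
  simp only [sin_shape1, sin_shape2, sin_shape3, sin_shape4, sin_shape5, sin_shape6, sin_shape7, exp_three_mul_sub_div_eight]
  set ζ := cexp (↑π / 8 * I) with _hζ
  set E₁ := cexp (3 * (θ₁ : ℂ) / 8 * I) with _hE₁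
  set E₂ := cexp (3 * (θ₂ : ℂ) / 8 * I) with _hE₂
  have _hz : ζ ≠ 0 := exp_pi_div_eight_ne_zero
  have _hX₁ : E₁ ≠ 0 := exp_ne_zero _
  have _hX₂ : E₂ ≠ 0 := exp_ne_zero _
  have hred : ∀ n : ℕ, 8 ≤ n → ζ ^ n = -ζ ^ (n - 8) := exp_pi_div_eight_pow_red
  field_simp
  ring_nf
  simp (disch := decide) only [hred]
  ring_nf

/-- **Yang–Baxter equation, pairing `E1 ↔ E5`** (`k = 1`): in `𝖧` the families realising it weigh
`u₁(θ₁)·v(θ₂) + u₂(δ)·u₂(θ₂)·v(θ₁)`, in `𝖧'` they weigh `u₁(δ)·u₁(θ₂)·v(θ₁) + u₁(θ₁)·v(δ)`.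
[cite: GlazmanManolescu2019, Proposition 3.1] -/
theorem yangBaxter_E1E5 (θ₁ θ₂ : ℝ) (h₁ : weightDen θ₁ ≠ 0) (h₂ : weightDen θ₂ ≠ 0)
    (h₃ : weightDen (θ₂ - θ₁) ≠ 0) :
    weightU1 θ₁ * weightV θ₂ + weightU2 (θ₂ - θ₁) * weightU2 θ₂ * weightV θ₁ =
      weightU1 (θ₂ - θ₁) * weightU1 θ₂ * weightV θ₁ + weightU1 θ₁ * weightV (θ₂ - θ₁) := by
  obtain ⟨_hi1, _hi2⟩ := den_ne_zero_complex h₁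
  obtain ⟨_hj1, _hj2⟩ := den_ne_zero_complex h₂
  obtain ⟨_hd1, _hd2⟩ := den_sub_ne_zero_complex h₃
  obtain ⟨_hd3, _hd4⟩ := den_ne_zero_complex h₃
  push_cast at _hd3 _hd4
  rw [exp_three_mul_sub_div_eight] at _hd3 _hd4
  apply Complex.ofReal_injective
  push_cast [weightU1, weightU2, weightV, weightDen]
  simp only [sin_shape1, sin_shape2, sin_shape3, sin_shape4, sin_shape5, sin_shape6, exp_three_mul_sub_div_eight]
  set ζ := cexp (↑π / 8 * I) with _hζ
  set E₁ := cexp (3 * (θ₁ : ℂ) / 8 * I) with _hE₁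
  set E₂ := cexp (3 * (θ₂ : ℂ) / 8 * I) with _hE₂
  have _hz : ζ ≠ 0 := exp_pi_div_eight_ne_zero
  have _hX₁ : E₁ ≠ 0 := exp_ne_zero _
  have _hX₂ : E₂ ≠ 0 := exp_ne_zero _
  have hred : ∀ n : ℕ, 8 ≤ n → ζ ^ n = -ζ ^ (n - 8) := exp_pi_div_eight_pow_red
  field_simp
  ring_nf
  simp (disch := decide) only [hred]
  ring_nf

/-- **Yang–Baxter equation, pairing `E2 ↔ E3`** (`k = 1`): in `𝖧` the families realising it weigh
`u₁(θ₂)·u₂(θ₁)·w₁(δ) + u₂(δ)`, in `𝖧'` they weigh `u₁(θ₁)·u₂(θ₂) + u₂(δ)·v(θ₁)·v(θ₂)`.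
[cite: GlazmanManolescu2019, Proposition 3.1] -/
theorem yangBaxter_E2E3 (θ₁ θ₂ : ℝ) (h₁ : weightDen θ₁ ≠ 0) (h₂ : weightDen θ₂ ≠ 0)
    (h₃ : weightDen (θ₂ - θ₁) ≠ 0) :
    weightU1 θ₂ * weightU2 θ₁ * weightW1 (θ₂ - θ₁) + weightU2 (θ₂ - θ₁) =
      weightU1 θ₁ * weightU2 θ₂ + weightU2 (θ₂ - θ₁) * weightV θ₁ * weightV θ₂ := by
  obtain ⟨_hi1, _hi2⟩ := den_ne_zero_complex h₁
  obtain ⟨_hj1, _hj2⟩ := den_ne_zero_complex h₂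
  obtain ⟨_hd1, _hd2⟩ := den_sub_ne_zero_complex h₃
  obtain ⟨_hd3, _hd4⟩ := den_ne_zero_complex h₃
  push_cast at _hd3 _hd4
  rw [exp_three_mul_sub_div_eight] at _hd3 _hd4
  apply Complex.ofReal_injective
  push_cast [weightU1, weightU2, weightV, weightW1, weightDen]
  simp only [sin_shape1, sin_shape2, sin_shape3, sin_shape4, sin_shape5, sin_shape6, sin_shape7, exp_three_mul_sub_div_eight]
  set ζ := cexp (↑π / 8 * I) with _hζ
  set E₁ := cexp (3 * (θ₁ : ℂ) / 8 * I) with _hE₁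
  set E₂ := cexp (3 * (θ₂ : ℂ) / 8 * I) with _hE₂
  have _hz : ζ ≠ 0 := exp_pi_div_eight_ne_zero
  have _hX₁ : E₁ ≠ 0 := exp_ne_zero _
  have _hX₂ : E₂ ≠ 0 := exp_ne_zero _
  have hred : ∀ n : ℕ, 8 ≤ n → ζ ^ n = -ζ ^ (n - 8) := exp_pi_div_eight_pow_red
  field_simp
  ring_nf
  simp (disch := decide) only [hred]
  ring_nf

/-- **Yang–Baxter equation, pairing `E2 ↔ E5`** (`k = 1`): in `𝖧` the families realising it weigh
`u₁(δ)·u₂(θ₁)·v(θ₂) + u₂(θ₂)·v(δ)`, in `𝖧'` they weigh `u₁(θ₁)·u₂(δ)·v(θ₂) + u₂(θ₂)·v(θ₁)`.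
[cite: GlazmanManolescu2019, Proposition 3.1] -/
theorem yangBaxter_E2E5 (θ₁ θ₂ : ℝ) (h₁ : weightDen θ₁ ≠ 0) (h₂ : weightDen θ₂ ≠ 0)
    (h₃ : weightDen (θ₂ - θ₁) ≠ 0) :
    weightU1 (θ₂ - θ₁) * weightU2 θ₁ * weightV θ₂ + weightU2 θ₂ * weightV (θ₂ - θ₁) =
      weightU1 θ₁ * weightU2 (θ₂ - θ₁) * weightV θ₂ + weightU2 θ₂ * weightV θ₁ := by
  obtain ⟨_hi1, _hi2⟩ := den_ne_zero_complex h₁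
  obtain ⟨_hj1, _hj2⟩ := den_ne_zero_complex h₂
  obtain ⟨_hd1, _hd2⟩ := den_sub_ne_zero_complex h₃
  obtain ⟨_hd3, _hd4⟩ := den_ne_zero_complex h₃
  push_cast at _hd3 _hd4
  rw [exp_three_mul_sub_div_eight] at _hd3 _hd4
  apply Complex.ofReal_injective
  push_cast [weightU1, weightU2, weightV, weightDen]
  simp only [sin_shape1, sin_shape2, sin_shape3, sin_shape4, sin_shape5, sin_shape6, exp_three_mul_sub_div_eight]
  set ζ := cexp (↑π / 8 * I) with _hζ
  set E₁ := cexp (3 * (θ₁ : ℂ) / 8 * I) with _hE₁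
  set E₂ := cexp (3 * (θ₂ : ℂ) / 8 * I) with _hE₂
  have _hz : ζ ≠ 0 := exp_pi_div_eight_ne_zero
  have _hX₁ : E₁ ≠ 0 := exp_ne_zero _
  have _hX₂ : E₂ ≠ 0 := exp_ne_zero _
  have hred : ∀ n : ℕ, 8 ≤ n → ζ ^ n = -ζ ^ (n - 8) := exp_pi_div_eight_pow_red
  field_simp
  ring_nf
  simp (disch := decide) only [hred]
  ring_nf

/-- **Yang–Baxter equation, pairing `E3 ↔ E4`** (`k = 1`): in `𝖧` the families realising it weigh
`u₁(δ)·v(θ₂) + u₂(θ₁)·u₂(θ₂)·v(δ)`, in `𝖧'` they weigh `u₁(δ)·v(θ₁) + u₁(θ₁)·u₁(θ₂)·v(δ)`.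
[cite: GlazmanManolescu2019, Proposition 3.1] -/
theorem yangBaxter_E3E4 (θ₁ θ₂ : ℝ) (h₁ : weightDen θ₁ ≠ 0) (h₂ : weightDen θ₂ ≠ 0)
    (h₃ : weightDen (θ₂ - θ₁) ≠ 0) :
    weightU1 (θ₂ - θ₁) * weightV θ₂ + weightU2 θ₁ * weightU2 θ₂ * weightV (θ₂ - θ₁) =
      weightU1 (θ₂ - θ₁) * weightV θ₁ + weightU1 θ₁ * weightU1 θ₂ * weightV (θ₂ - θ₁) := by
  obtain ⟨_hi1, _hi2⟩ := den_ne_zero_complex h₁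
  obtain ⟨_hj1, _hj2⟩ := den_ne_zero_complex h₂
  obtain ⟨_hd1, _hd2⟩ := den_sub_ne_zero_complex h₃
  obtain ⟨_hd3, _hd4⟩ := den_ne_zero_complex h₃
  push_cast at _hd3 _hd4
  rw [exp_three_mul_sub_div_eight] at _hd3 _hd4
  apply Complex.ofReal_injective
  push_cast [weightU1, weightU2, weightV, weightDen]
  simp only [sin_shape1, sin_shape2, sin_shape3, sin_shape4, sin_shape5, sin_shape6, exp_three_mul_sub_div_eight]
  set ζ := cexp (↑π / 8 * I) with _hζ
  set E₁ := cexp (3 * (θ₁ : ℂ) / 8 * I) with _hE₁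
  set E₂ := cexp (3 * (θ₂ : ℂ) / 8 * I) with _hE₂
  have _hz : ζ ≠ 0 := exp_pi_div_eight_ne_zero
  have _hX₁ : E₁ ≠ 0 := exp_ne_zero _
  have _hX₂ : E₂ ≠ 0 := exp_ne_zero _
  have hred : ∀ n : ℕ, 8 ≤ n → ζ ^ n = -ζ ^ (n - 8) := exp_pi_div_eight_pow_red
  field_simp
  ring_nf
  simp (disch := decide) only [hred]
  ring_nf

/-- **Yang–Baxter equation, pairing `E3 ↔ E5`** (`k = 1`): in `𝖧` the families realising it weigh
`u₁(δ)·u₂(θ₂) + u₂(θ₁)·v(δ)·v(θ₂)`, in `𝖧'` they weigh `u₁(θ₂)·u₂(δ)·w₁(θ₁) + u₂(θ₁)`.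
[cite: GlazmanManolescu2019, Proposition 3.1] -/
theorem yangBaxter_E3E5 (θ₁ θ₂ : ℝ) (h₁ : weightDen θ₁ ≠ 0) (h₂ : weightDen θ₂ ≠ 0)
    (h₃ : weightDen (θ₂ - θ₁) ≠ 0) :
    weightU1 (θ₂ - θ₁) * weightU2 θ₂ + weightU2 θ₁ * weightV (θ₂ - θ₁) * weightV θ₂ =
      weightU1 θ₂ * weightU2 (θ₂ - θ₁) * weightW1 θ₁ + weightU2 θ₁ := by
  obtain ⟨_hi1, _hi2⟩ := den_ne_zero_complex h₁
  obtain ⟨_hj1, _hj2⟩ := den_ne_zero_complex h₂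
  obtain ⟨_hd1, _hd2⟩ := den_sub_ne_zero_complex h₃
  obtain ⟨_hd3, _hd4⟩ := den_ne_zero_complex h₃
  push_cast at _hd3 _hd4
  rw [exp_three_mul_sub_div_eight] at _hd3 _hd4
  apply Complex.ofReal_injective
  push_cast [weightU1, weightU2, weightV, weightW1, weightDen]
  simp only [sin_shape1, sin_shape2, sin_shape3, sin_shape4, sin_shape5, sin_shape6, sin_shape7, exp_three_mul_sub_div_eight]
  set ζ := cexp (↑π / 8 * I) with _hζ
  set E₁ := cexp (3 * (θ₁ : ℂ) / 8 * I) with _hE₁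
  set E₂ := cexp (3 * (θ₂ : ℂ) / 8 * I) with _hE₂
  have _hz : ζ ≠ 0 := exp_pi_div_eight_ne_zero
  have _hX₁ : E₁ ≠ 0 := exp_ne_zero _
  have _hX₂ : E₂ ≠ 0 := exp_ne_zero _
  have hred : ∀ n : ℕ, 8 ≤ n → ζ ^ n = -ζ ^ (n - 8) := exp_pi_div_eight_pow_red
  field_simp
  ring_nf
  simp (disch := decide) only [hred]
  ring_nf

/-- **Yang–Baxter equation, pairing `E4 ↔ E5`** (`k = 1`): in `𝖧` the families realising it weigh
`u₁(θ₂) + u₂(δ)·u₂(θ₁)·w₂(θ₂)`, in `𝖧'` they weigh `u₁(δ)·u₁(θ₁) + u₁(θ₂)·v(δ)·v(θ₁)`.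
[cite: GlazmanManolescu2019, Proposition 3.1] -/
theorem yangBaxter_E4E5 (θ₁ θ₂ : ℝ) (h₁ : weightDen θ₁ ≠ 0) (h₂ : weightDen θ₂ ≠ 0)
    (h₃ : weightDen (θ₂ - θ₁) ≠ 0) :
    weightU1 θ₂ + weightU2 (θ₂ - θ₁) * weightU2 θ₁ * weightW2 θ₂ =
      weightU1 (θ₂ - θ₁) * weightU1 θ₁ + weightU1 θ₂ * weightV (θ₂ - θ₁) * weightV θ₁ := by
  obtain ⟨_hi1, _hi2⟩ := den_ne_zero_complex h₁
  obtain ⟨_hj1, _hj2⟩ := den_ne_zero_complex h₂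
  obtain ⟨_hd1, _hd2⟩ := den_sub_ne_zero_complex h₃
  obtain ⟨_hd3, _hd4⟩ := den_ne_zero_complex h₃
  push_cast at _hd3 _hd4
  rw [exp_three_mul_sub_div_eight] at _hd3 _hd4
  apply Complex.ofReal_injective
  push_cast [weightU1, weightU2, weightV, weightW2, weightDen]
  simp only [sin_shape1, sin_shape2, sin_shape3, sin_shape4, sin_shape5, sin_shape6, sin_shape8, exp_three_mul_sub_div_eight]
  set ζ := cexp (↑π / 8 * I) with _hζ
  set E₁ := cexp (3 * (θ₁ : ℂ) / 8 * I) with _hE₁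
  set E₂ := cexp (3 * (θ₂ : ℂ) / 8 * I) with _hE₂
  have _hz : ζ ≠ 0 := exp_pi_div_eight_ne_zero
  have _hX₁ : E₁ ≠ 0 := exp_ne_zero _
  have _hX₂ : E₂ ≠ 0 := exp_ne_zero _
  have hred : ∀ n : ℕ, 8 ≤ n → ζ ^ n = -ζ ^ (n - 8) := exp_pi_div_eight_pow_red
  field_simp
  ring_nf
  simp (disch := decide) only [hred]
  ring_nf

/-- **Yang–Baxter equation, pairing `E0 ↔ E1, E2 ↔ E3`** (`k = 2`): in `𝖧` the families realising it weigh
`u₁(θ₂)·w₁(δ)·w₂(θ₁) + u₁(θ₂)·w₁(θ₁)·w₂(δ) + u₂(δ)·u₂(θ₁)`, in `𝖧'` they weigh `u₁(δ)·u₁(θ₁)·w₂(θ₂)`.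
[cite: GlazmanManolescu2019, Proposition 3.1] -/
theorem yangBaxter_E0E1_E2E3 (θ₁ θ₂ : ℝ) (h₁ : weightDen θ₁ ≠ 0) (h₂ : weightDen θ₂ ≠ 0)
    (h₃ : weightDen (θ₂ - θ₁) ≠ 0) :
    weightU1 θ₂ * weightW1 (θ₂ - θ₁) * weightW2 θ₁ + weightU1 θ₂ * weightW1 θ₁ * weightW2 (θ₂ - θ₁) + weightU2 (θ₂ - θ₁) * weightU2 θ₁ =
      weightU1 (θ₂ - θ₁) * weightU1 θ₁ * weightW2 θ₂ := by
  obtain ⟨_hi1, _hi2⟩ := den_ne_zero_complex h₁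
  obtain ⟨_hj1, _hj2⟩ := den_ne_zero_complex h₂
  obtain ⟨_hd1, _hd2⟩ := den_sub_ne_zero_complex h₃
  obtain ⟨_hd3, _hd4⟩ := den_ne_zero_complex h₃
  push_cast at _hd3 _hd4
  rw [exp_three_mul_sub_div_eight] at _hd3 _hd4
  apply Complex.ofReal_injective
  push_cast [weightU1, weightU2, weightW1, weightW2, weightDen]
  simp only [sin_shape1, sin_shape2, sin_shape3, sin_shape4, sin_shape5, sin_shape6, sin_shape7, sin_shape8, exp_three_mul_sub_div_eight]
  set ζ := cexp (↑π / 8 * I) with _hζ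
  set E₁ := cexp (3 * (θ₁ : ℂ) / 8 * I) with _hE₁
  set E₂ := cexp (3 * (θ₂ : ℂ) / 8 * I) with _hE₂
  have _hz : ζ ≠ 0 := exp_pi_div_eight_ne_zero
  have _hX₁ : E₁ ≠ 0 := exp_ne_zero _
  have _hX₂ : E₂ ≠ 0 := exp_ne_zero _
  have hred : ∀ n : ℕ, 8 ≤ n → ζ ^ n = -ζ ^ (n - 8) := exp_pi_div_eight_pow_red
  field_simp
  ring_nf
  simp (disch := decide) only [hred]
  ring_nf

/-- **Yang–Baxter equation, pairing `E0 ↔ E2, E1 ↔ E3`** (`k = 2`): in `𝖧` the families realising it weigh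
`u₁(θ₂)·w₁(δ)·w₁(θ₁)`, in `𝖧'` they weigh `u₁(δ)·u₁(θ₁)·w₁(θ₂) + u₁(θ₂)·v(δ)·v(θ₁)`.
[cite: GlazmanManolescu2019, Proposition 3.1] -/
theorem yangBaxter_E0E2_E1E3 (θ₁ θ₂ : ℝ) (h₁ : weightDen θ₁ ≠ 0) (h₂ : weightDen θ₂ ≠ 0)
    (h₃ : weightDen (θ₂ - θ₁) ≠ 0) :
    weightU1 θ₂ * weightW1 (θ₂ - θ₁) * weightW1 θ₁ =
      weightU1 (θ₂ - θ₁) * weightU1 θ₁ * weightW1 θ₂ + weightU1 θ₂ * weightV (θ₂ - θ₁) * weightV θ₁ := by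
  obtain ⟨_hi1, _hi2⟩ := den_ne_zero_complex h₁
  obtain ⟨_hj1, _hj2⟩ := den_ne_zero_complex h₂
  obtain ⟨_hd1, _hd2⟩ := den_sub_ne_zero_complex h₃
  obtain ⟨_hd3, _hd4⟩ := den_ne_zero_complex h₃
  push_cast at _hd3 _hd4
  rw [exp_three_mul_sub_div_eight] at _hd3 _hd4
  apply Complex.ofReal_injective
  push_cast [weightU1, weightV, weightW1, weightDen]
  simp only [sin_shape1, sin_shape2, sin_shape3, sin_shape4, sin_shape6, sin_shape7, exp_three_mul_sub_div_eight]
  set ζ := cexp (↑π / 8 * I) with _hζ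
  set E₁ := cexp (3 * (θ₁ : ℂ) / 8 * I) with _hE₁
  set E₂ := cexp (3 * (θ₂ : ℂ) / 8 * I) with _hE₂
  have _hz : ζ ≠ 0 := exp_pi_div_eight_ne_zero
  have _hX₁ : E₁ ≠ 0 := exp_ne_zero _
  have _hX₂ : E₂ ≠ 0 := exp_ne_zero _
  have hred : ∀ n : ℕ, 8 ≤ n → ζ ^ n = -ζ ^ (n - 8) := exp_pi_div_eight_pow_red
  field_simp
  ring_nf
  simp (disch := decide) only [hred]
  ring_nf

/-- **Yang–Baxter equation, pairing `E0 ↔ E1, E2 ↔ E4`** (`k = 2`): in `𝖧` the families realising it weigh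
`u₁(δ)·u₂(θ₂)·w₂(θ₁) + u₂(θ₁)·v(δ)·v(θ₂)`, in `𝖧'` they weigh `u₂(θ₁)·w₁(δ)·w₂(θ₂)`.
[cite: GlazmanManolescu2019, Proposition 3.1] -/
theorem yangBaxter_E0E1_E2E4 (θ₁ θ₂ : ℝ) (h₁ : weightDen θ₁ ≠ 0) (h₂ : weightDen θ₂ ≠ 0)
    (h₃ : weightDen (θ₂ - θ₁) ≠ 0) :
    weightU1 (θ₂ - θ₁) * weightU2 θ₂ * weightW2 θ₁ + weightU2 θ₁ * weightV (θ₂ - θ₁) * weightV θ₂ =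
      weightU2 θ₁ * weightW1 (θ₂ - θ₁) * weightW2 θ₂ := by
  obtain ⟨_hi1, _hi2⟩ := den_ne_zero_complex h₁
  obtain ⟨_hj1, _hj2⟩ := den_ne_zero_complex h₂
  obtain ⟨_hd1, _hd2⟩ := den_sub_ne_zero_complex h₃
  obtain ⟨_hd3, _hd4⟩ := den_ne_zero_complex h₃
  push_cast at _hd3 _hd4
  rw [exp_three_mul_sub_div_eight] at _hd3 _hd4
  apply Complex.ofReal_injective
  push_cast [weightU1, weightU2, weightV, weightW1, weightW2, weightDen]
  simp only [sin_shape1, sin_shape2, sin_shape3, sin_shape4, sin_shape5, sin_shape6, sin_shape7, sin_shape8, exp_three_mul_sub_div_eight]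
  set ζ := cexp (↑π / 8 * I) with _hζ
  set E₁ := cexp (3 * (θ₁ : ℂ) / 8 * I) with _hE₁
  set E₂ := cexp (3 * (θ₂ : ℂ) / 8 * I) with _hE₂
  have _hz : ζ ≠ 0 := exp_pi_div_eight_ne_zero
  have _hX₁ : E₁ ≠ 0 := exp_ne_zero _
  have _hX₂ : E₂ ≠ 0 := exp_ne_zero _
  have hred : ∀ n : ℕ, 8 ≤ n → ζ ^ n = -ζ ^ (n - 8) := exp_pi_div_eight_pow_red
  field_simp
  ring_nf
  simp (disch := decide) only [hred]
  ring_nf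

/-- **Yang–Baxter equation, pairing `E0 ↔ E2, E1 ↔ E4`** (`k = 2`): in `𝖧` the families realising it weigh
`u₁(δ)·u₂(θ₂)·w₁(θ₁)`, in `𝖧'` they weigh `u₁(θ₂)·u₂(δ) + u₂(θ₁)·w₁(δ)·w₁(θ₂) + u₂(θ₁)·w₂(δ)·w₂(θ₂)`.
[cite: GlazmanManolescu2019, Proposition 3.1] -/
theorem yangBaxter_E0E2_E1E4 (θ₁ θ₂ : ℝ) (h₁ : weightDen θ₁ ≠ 0) (h₂ : weightDen θ₂ ≠ 0)
    (h₃ : weightDen (θ₂ - θ₁) ≠ 0) :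
    weightU1 (θ₂ - θ₁) * weightU2 θ₂ * weightW1 θ₁ =
      weightU1 θ₂ * weightU2 (θ₂ - θ₁) + weightU2 θ₁ * weightW1 (θ₂ - θ₁) * weightW1 θ₂ + weightU2 θ₁ * weightW2 (θ₂ - θ₁) * weightW2 θ₂ := by
  obtain ⟨_hi1, _hi2⟩ := den_ne_zero_complex h₁
  obtain ⟨_hj1, _hj2⟩ := den_ne_zero_complex h₂
  obtain ⟨_hd1, _hd2⟩ := den_sub_ne_zero_complex h₃
  obtain ⟨_hd3, _hd4⟩ := den_ne_zero_complex h₃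
  push_cast at _hd3 _hd4
  rw [exp_three_mul_sub_div_eight] at _hd3 _hd4
  apply Complex.ofReal_injective
  push_cast [weightU1, weightU2, weightW1, weightW2, weightDen]
  simp only [sin_shape1, sin_shape2, sin_shape3, sin_shape4, sin_shape5, sin_shape6, sin_shape7, sin_shape8, exp_three_mul_sub_div_eight]
  set ζ := cexp (↑π / 8 * I) with _hζ
  set E₁ := cexp (3 * (θ₁ : ℂ) / 8 * I) with _hE₁
  set E₂ := cexp (3 * (θ₂ : ℂ) / 8 * I) with _hE₂
  have _hz : ζ ≠ 0 := exp_pi_div_eight_ne_zero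
  have _hX₁ : E₁ ≠ 0 := exp_ne_zero _
  have _hX₂ : E₂ ≠ 0 := exp_ne_zero _
  have hred : ∀ n : ℕ, 8 ≤ n → ζ ^ n = -ζ ^ (n - 8) := exp_pi_div_eight_pow_red
  field_simp
  ring_nf
  simp (disch := decide) only [hred]
  ring_nf

/-- **Yang–Baxter equation, pairing `E0 ↔ E1, E2 ↔ E5`** (`k = 2`): in `𝖧` the families realising it weigh
`u₁(δ)·v(θ₂)·w₂(θ₁) + u₂(θ₁)·u₂(θ₂)·v(δ)`, in `𝖧'` they weigh `u₁(δ)·v(θ₁)·w₂(θ₂)`.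
[cite: GlazmanManolescu2019, Proposition 3.1] -/
theorem yangBaxter_E0E1_E2E5 (θ₁ θ₂ : ℝ) (h₁ : weightDen θ₁ ≠ 0) (h₂ : weightDen θ₂ ≠ 0)
    (h₃ : weightDen (θ₂ - θ₁) ≠ 0) :
    weightU1 (θ₂ - θ₁) * weightV θ₂ * weightW2 θ₁ + weightU2 θ₁ * weightU2 θ₂ * weightV (θ₂ - θ₁) =
      weightU1 (θ₂ - θ₁) * weightV θ₁ * weightW2 θ₂ := by
  obtain ⟨_hi1, _hi2⟩ := den_ne_zero_complex h₁
  obtain ⟨_hj1, _hj2⟩ := den_ne_zero_complex h₂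
  obtain ⟨_hd1, _hd2⟩ := den_sub_ne_zero_complex h₃
  obtain ⟨_hd3, _hd4⟩ := den_ne_zero_complex h₃
  push_cast at _hd3 _hd4
  rw [exp_three_mul_sub_div_eight] at _hd3 _hd4
  apply Complex.ofReal_injective
  push_cast [weightU1, weightU2, weightV, weightW2, weightDen]
  simp only [sin_shape1, sin_shape2, sin_shape3, sin_shape4, sin_shape5, sin_shape6, sin_shape8, exp_three_mul_sub_div_eight]
  set ζ := cexp (↑π / 8 * I) with _hζ
  set E₁ := cexp (3 * (θ₁ : ℂ) / 8 * I) with _hE₁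
  set E₂ := cexp (3 * (θ₂ : ℂ) / 8 * I) with _hE₂
  have _hz : ζ ≠ 0 := exp_pi_div_eight_ne_zero
  have _hX₁ : E₁ ≠ 0 := exp_ne_zero _
  have _hX₂ : E₂ ≠ 0 := exp_ne_zero _
  have hred : ∀ n : ℕ, 8 ≤ n → ζ ^ n = -ζ ^ (n - 8) := exp_pi_div_eight_pow_red
  field_simp
  ring_nf
  simp (disch := decide) only [hred]
  ring_nf

/-- **Yang–Baxter equation, pairing `E0 ↔ E2, E1 ↔ E5`** (`k = 2`): in `𝖧` the families realising it weigh
`u₁(δ)·v(θ₂)·w₁(θ₁)`, in `𝖧'` they weigh `u₁(δ)·v(θ₁)·w₁(θ₂) + u₁(θ₁)·u₁(θ₂)·v(δ)`.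
[cite: GlazmanManolescu2019, Proposition 3.1] -/
theorem yangBaxter_E0E2_E1E5 (θ₁ θ₂ : ℝ) (h₁ : weightDen θ₁ ≠ 0) (h₂ : weightDen θ₂ ≠ 0)
    (h₃ : weightDen (θ₂ - θ₁) ≠ 0) :
    weightU1 (θ₂ - θ₁) * weightV θ₂ * weightW1 θ₁ =
      weightU1 (θ₂ - θ₁) * weightV θ₁ * weightW1 θ₂ + weightU1 θ₁ * weightU1 θ₂ * weightV (θ₂ - θ₁) := by
  obtain ⟨_hi1, _hi2⟩ := den_ne_zero_complex h₁
  obtain ⟨_hj1, _hj2⟩ := den_ne_zero_complex h₂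
  obtain ⟨_hd1, _hd2⟩ := den_sub_ne_zero_complex h₃
  obtain ⟨_hd3, _hd4⟩ := den_ne_zero_complex h₃
  push_cast at _hd3 _hd4
  rw [exp_three_mul_sub_div_eight] at _hd3 _hd4
  apply Complex.ofReal_injective
  push_cast [weightU1, weightV, weightW1, weightDen]
  simp only [sin_shape1, sin_shape2, sin_shape3, sin_shape4, sin_shape6, sin_shape7, exp_three_mul_sub_div_eight]
  set ζ := cexp (↑π / 8 * I) with _hζ
  set E₁ := cexp (3 * (θ₁ : ℂ) / 8 * I) with _hE₁
  set E₂ := cexp (3 * (θ₂ : ℂ) / 8 * I) with _hE₂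
  have _hz : ζ ≠ 0 := exp_pi_div_eight_ne_zero
  have _hX₁ : E₁ ≠ 0 := exp_ne_zero _
  have _hX₂ : E₂ ≠ 0 := exp_ne_zero _
  have hred : ∀ n : ℕ, 8 ≤ n → ζ ^ n = -ζ ^ (n - 8) := exp_pi_div_eight_pow_red
  field_simp
  ring_nf
  simp (disch := decide) only [hred]
  ring_nf

/-- **Yang–Baxter equation, pairing `E0 ↔ E1, E3 ↔ E4`** (`k = 2`): in `𝖧` the families realising it weigh
`u₁(δ)·u₂(θ₁)·v(θ₂) + u₂(θ₂)·v(δ)·w₂(θ₁)`, in `𝖧'` they weigh `u₂(θ₂)·v(θ₁)·w₁(δ)`.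
[cite: GlazmanManolescu2019, Proposition 3.1] -/
theorem yangBaxter_E0E1_E3E4 (θ₁ θ₂ : ℝ) (h₁ : weightDen θ₁ ≠ 0) (h₂ : weightDen θ₂ ≠ 0)
    (h₃ : weightDen (θ₂ - θ₁) ≠ 0) :
    weightU1 (θ₂ - θ₁) * weightU2 θ₁ * weightV θ₂ + weightU2 θ₂ * weightV (θ₂ - θ₁) * weightW2 θ₁ =
      weightU2 θ₂ * weightV θ₁ * weightW1 (θ₂ - θ₁) := by
  obtain ⟨_hi1, _hi2⟩ := den_ne_zero_complex h₁
  obtain ⟨_hj1, _hj2⟩ := den_ne_zero_complex h₂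
  obtain ⟨_hd1, _hd2⟩ := den_sub_ne_zero_complex h₃
  obtain ⟨_hd3, _hd4⟩ := den_ne_zero_complex h₃
  push_cast at _hd3 _hd4
  rw [exp_three_mul_sub_div_eight] at _hd3 _hd4
  apply Complex.ofReal_injective
  push_cast [weightU1, weightU2, weightV, weightW1, weightW2, weightDen]
  simp only [sin_shape1, sin_shape2, sin_shape3, sin_shape4, sin_shape5, sin_shape6, sin_shape7, sin_shape8, exp_three_mul_sub_div_eight]
  set ζ := cexp (↑π / 8 * I) with _hζ
  set E₁ := cexp (3 * (θ₁ : ℂ) / 8 * I) with _hE₁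
  set E₂ := cexp (3 * (θ₂ : ℂ) / 8 * I) with _hE₂
  have _hz : ζ ≠ 0 := exp_pi_div_eight_ne_zero
  have _hX₁ : E₁ ≠ 0 := exp_ne_zero _
  have _hX₂ : E₂ ≠ 0 := exp_ne_zero _
  have hred : ∀ n : ℕ, 8 ≤ n → ζ ^ n = -ζ ^ (n - 8) := exp_pi_div_eight_pow_red
  field_simp
  ring_nf
  simp (disch := decide) only [hred]
  ring_nf

/-- **Yang–Baxter equation, pairing `E0 ↔ E3, E1 ↔ E4`** (`k = 2`): in `𝖧` the families realising it weigh
`u₂(θ₂)·v(δ)·w₁(θ₁)`, in `𝖧'` they weigh `u₁(θ₁)·u₂(δ)·v(θ₂) + u₂(θ₂)·v(θ₁)·w₂(δ)`.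
[cite: GlazmanManolescu2019, Proposition 3.1] -/
theorem yangBaxter_E0E3_E1E4 (θ₁ θ₂ : ℝ) (h₁ : weightDen θ₁ ≠ 0) (h₂ : weightDen θ₂ ≠ 0)
    (h₃ : weightDen (θ₂ - θ₁) ≠ 0) :
    weightU2 θ₂ * weightV (θ₂ - θ₁) * weightW1 θ₁ =
      weightU1 θ₁ * weightU2 (θ₂ - θ₁) * weightV θ₂ + weightU2 θ₂ * weightV θ₁ * weightW2 (θ₂ - θ₁) := by
  obtain ⟨_hi1, _hi2⟩ := den_ne_zero_complex h₁
  obtain ⟨_hj1, _hj2⟩ := den_ne_zero_complex h₂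
  obtain ⟨_hd1, _hd2⟩ := den_sub_ne_zero_complex h₃
  obtain ⟨_hd3, _hd4⟩ := den_ne_zero_complex h₃
  push_cast at _hd3 _hd4
  rw [exp_three_mul_sub_div_eight] at _hd3 _hd4
  apply Complex.ofReal_injective
  push_cast [weightU1, weightU2, weightV, weightW1, weightW2, weightDen]
  simp only [sin_shape1, sin_shape2, sin_shape3, sin_shape4, sin_shape5, sin_shape6, sin_shape7, sin_shape8, exp_three_mul_sub_div_eight]
  set ζ := cexp (↑π / 8 * I) with _hζ
  set E₁ := cexp (3 * (θ₁ : ℂ) / 8 * I) with _hE₁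
  set E₂ := cexp (3 * (θ₂ : ℂ) / 8 * I) with _hE₂
  have _hz : ζ ≠ 0 := exp_pi_div_eight_ne_zero
  have _hX₁ : E₁ ≠ 0 := exp_ne_zero _
  have _hX₂ : E₂ ≠ 0 := exp_ne_zero _
  have hred : ∀ n : ℕ, 8 ≤ n → ζ ^ n = -ζ ^ (n - 8) := exp_pi_div_eight_pow_red
  field_simp
  ring_nf
  simp (disch := decide) only [hred]
  ring_nf

/-- **Yang–Baxter equation, pairing `E0 ↔ E1, E4 ↔ E5`** (`k = 2`): in `𝖧` the families realising it weigh
`u₁(θ₂)·u₂(θ₁) + u₂(δ)·w₁(θ₁)·w₁(θ₂) + u₂(δ)·w₂(θ₁)·w₂(θ₂)`, in `𝖧'` they weigh `u₁(θ₁)·u₂(θ₂)·w₁(δ)`.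
[cite: GlazmanManolescu2019, Proposition 3.1] -/
theorem yangBaxter_E0E1_E4E5 (θ₁ θ₂ : ℝ) (h₁ : weightDen θ₁ ≠ 0) (h₂ : weightDen θ₂ ≠ 0)
    (h₃ : weightDen (θ₂ - θ₁) ≠ 0) :
    weightU1 θ₂ * weightU2 θ₁ + weightU2 (θ₂ - θ₁) * weightW1 θ₁ * weightW1 θ₂ + weightU2 (θ₂ - θ₁) * weightW2 θ₁ * weightW2 θ₂ =
      weightU1 θ₁ * weightU2 θ₂ * weightW1 (θ₂ - θ₁) := by
  obtain ⟨_hi1, _hi2⟩ := den_ne_zero_complex h₁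
  obtain ⟨_hj1, _hj2⟩ := den_ne_zero_complex h₂
  obtain ⟨_hd1, _hd2⟩ := den_sub_ne_zero_complex h₃
  obtain ⟨_hd3, _hd4⟩ := den_ne_zero_complex h₃
  push_cast at _hd3 _hd4
  rw [exp_three_mul_sub_div_eight] at _hd3 _hd4
  apply Complex.ofReal_injective
  push_cast [weightU1, weightU2, weightW1, weightW2, weightDen]
  simp only [sin_shape1, sin_shape2, sin_shape3, sin_shape4, sin_shape5, sin_shape6, sin_shape7, sin_shape8, exp_three_mul_sub_div_eight]
  set ζ := cexp (↑π / 8 * I) with _hζ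
  set E₁ := cexp (3 * (θ₁ : ℂ) / 8 * I) with _hE₁
  set E₂ := cexp (3 * (θ₂ : ℂ) / 8 * I) with _hE₂
  have _hz : ζ ≠ 0 := exp_pi_div_eight_ne_zero
  have _hX₁ : E₁ ≠ 0 := exp_ne_zero _
  have _hX₂ : E₂ ≠ 0 := exp_ne_zero _
  have hred : ∀ n : ℕ, 8 ≤ n → ζ ^ n = -ζ ^ (n - 8) := exp_pi_div_eight_pow_red
  field_simp
  ring_nf
  simp (disch := decide) only [hred]
  ring_nf

/-- **Yang–Baxter equation, pairing `E0 ↔ E5, E1 ↔ E4`** (`k = 2`): in `𝖧` the families realising it weigh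
`u₂(δ)·w₁(θ₁)·w₂(θ₂)`, in `𝖧'` they weigh `u₁(θ₁)·u₂(θ₂)·w₂(δ) + u₂(δ)·v(θ₁)·v(θ₂)`.
[cite: GlazmanManolescu2019, Proposition 3.1] -/
theorem yangBaxter_E0E5_E1E4 (θ₁ θ₂ : ℝ) (h₁ : weightDen θ₁ ≠ 0) (h₂ : weightDen θ₂ ≠ 0)
    (h₃ : weightDen (θ₂ - θ₁) ≠ 0) :
    weightU2 (θ₂ - θ₁) * weightW1 θ₁ * weightW2 θ₂ =
      weightU1 θ₁ * weightU2 θ₂ * weightW2 (θ₂ - θ₁) + weightU2 (θ₂ - θ₁) * weightV θ₁ * weightV θ₂ := by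
  obtain ⟨_hi1, _hi2⟩ := den_ne_zero_complex h₁
  obtain ⟨_hj1, _hj2⟩ := den_ne_zero_complex h₂
  obtain ⟨_hd1, _hd2⟩ := den_sub_ne_zero_complex h₃
  obtain ⟨_hd3, _hd4⟩ := den_ne_zero_complex h₃
  push_cast at _hd3 _hd4
  rw [exp_three_mul_sub_div_eight] at _hd3 _hd4
  apply Complex.ofReal_injective
  push_cast [weightU1, weightU2, weightV, weightW1, weightW2, weightDen]
  simp only [sin_shape1, sin_shape2, sin_shape3, sin_shape4, sin_shape5, sin_shape6, sin_shape7, sin_shape8, exp_three_mul_sub_div_eight]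
  set ζ := cexp (↑π / 8 * I) with _hζ
  set E₁ := cexp (3 * (θ₁ : ℂ) / 8 * I) with _hE₁
  set E₂ := cexp (3 * (θ₂ : ℂ) / 8 * I) with _hE₂
  have _hz : ζ ≠ 0 := exp_pi_div_eight_ne_zero
  have _hX₁ : E₁ ≠ 0 := exp_ne_zero _
  have _hX₂ : E₂ ≠ 0 := exp_ne_zero _
  have hred : ∀ n : ℕ, 8 ≤ n → ζ ^ n = -ζ ^ (n - 8) := exp_pi_div_eight_pow_red
  field_simp
  ring_nf
  simp (disch := decide) only [hred]
  ring_nf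

/-- **Yang–Baxter equation, pairing `E0 ↔ E2, E3 ↔ E4`** (`k = 2`): in `𝖧` the families realising it weigh
`u₁(θ₁)·v(θ₂)·w₁(δ)`, in `𝖧'` they weigh `u₁(δ)·u₁(θ₂)·v(θ₁) + u₁(θ₁)·v(δ)·w₁(θ₂)`.
[cite: GlazmanManolescu2019, Proposition 3.1] -/
theorem yangBaxter_E0E2_E3E4 (θ₁ θ₂ : ℝ) (h₁ : weightDen θ₁ ≠ 0) (h₂ : weightDen θ₂ ≠ 0)
    (h₃ : weightDen (θ₂ - θ₁) ≠ 0) :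
    weightU1 θ₁ * weightV θ₂ * weightW1 (θ₂ - θ₁) =
      weightU1 (θ₂ - θ₁) * weightU1 θ₂ * weightV θ₁ + weightU1 θ₁ * weightV (θ₂ - θ₁) * weightW1 θ₂ := by
  obtain ⟨_hi1, _hi2⟩ := den_ne_zero_complex h₁
  obtain ⟨_hj1, _hj2⟩ := den_ne_zero_complex h₂
  obtain ⟨_hd1, _hd2⟩ := den_sub_ne_zero_complex h₃
  obtain ⟨_hd3, _hd4⟩ := den_ne_zero_complex h₃
  push_cast at _hd3 _hd4
  rw [exp_three_mul_sub_div_eight] at _hd3 _hd4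
  apply Complex.ofReal_injective
  push_cast [weightU1, weightV, weightW1, weightDen]
  simp only [sin_shape1, sin_shape2, sin_shape3, sin_shape4, sin_shape6, sin_shape7, exp_three_mul_sub_div_eight]
  set ζ := cexp (↑π / 8 * I) with _hζ
  set E₁ := cexp (3 * (θ₁ : ℂ) / 8 * I) with _hE₁
  set E₂ := cexp (3 * (θ₂ : ℂ) / 8 * I) with _hE₂
  have _hz : ζ ≠ 0 := exp_pi_div_eight_ne_zero
  have _hX₁ : E₁ ≠ 0 := exp_ne_zero _
  have _hX₂ : E₂ ≠ 0 := exp_ne_zero _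
  have hred : ∀ n : ℕ, 8 ≤ n → ζ ^ n = -ζ ^ (n - 8) := exp_pi_div_eight_pow_red
  field_simp
  ring_nf
  simp (disch := decide) only [hred]
  ring_nf

/-- **Yang–Baxter equation, pairing `E0 ↔ E4, E2 ↔ E3`** (`k = 2`): in `𝖧` the families realising it weigh
`u₁(θ₁)·v(θ₂)·w₂(δ) + u₂(δ)·u₂(θ₂)·v(θ₁)`, in `𝖧'` they weigh `u₁(θ₁)·v(δ)·w₂(θ₂)`.
[cite: GlazmanManolescu2019, Proposition 3.1] -/
theorem yangBaxter_E0E4_E2E3 (θ₁ θ₂ : ℝ) (h₁ : weightDen θ₁ ≠ 0) (h₂ : weightDen θ₂ ≠ 0)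
    (h₃ : weightDen (θ₂ - θ₁) ≠ 0) :
    weightU1 θ₁ * weightV θ₂ * weightW2 (θ₂ - θ₁) + weightU2 (θ₂ - θ₁) * weightU2 θ₂ * weightV θ₁ =
      weightU1 θ₁ * weightV (θ₂ - θ₁) * weightW2 θ₂ := by
  obtain ⟨_hi1, _hi2⟩ := den_ne_zero_complex h₁
  obtain ⟨_hj1, _hj2⟩ := den_ne_zero_complex h₂
  obtain ⟨_hd1, _hd2⟩ := den_sub_ne_zero_complex h₃
  obtain ⟨_hd3, _hd4⟩ := den_ne_zero_complex h₃
  push_cast at _hd3 _hd4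
  rw [exp_three_mul_sub_div_eight] at _hd3 _hd4
  apply Complex.ofReal_injective
  push_cast [weightU1, weightU2, weightV, weightW2, weightDen]
  simp only [sin_shape1, sin_shape2, sin_shape3, sin_shape4, sin_shape5, sin_shape6, sin_shape8, exp_three_mul_sub_div_eight]
  set ζ := cexp (↑π / 8 * I) with _hζ
  set E₁ := cexp (3 * (θ₁ : ℂ) / 8 * I) with _hE₁
  set E₂ := cexp (3 * (θ₂ : ℂ) / 8 * I) with _hE₂
  have _hz : ζ ≠ 0 := exp_pi_div_eight_ne_zero
  have _hX₁ : E₁ ≠ 0 := exp_ne_zero _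
  have _hX₂ : E₂ ≠ 0 := exp_ne_zero _
  have hred : ∀ n : ℕ, 8 ≤ n → ζ ^ n = -ζ ^ (n - 8) := exp_pi_div_eight_pow_red
  field_simp
  ring_nf
  simp (disch := decide) only [hred]
  ring_nf

/-- **Yang–Baxter equation, pairing `E0 ↔ E2, E3 ↔ E5`** (`k = 2`): in `𝖧` the families realising it weigh
`u₁(θ₁)·u₂(θ₂)·w₁(δ)`, in `𝖧'` they weigh `u₁(θ₂)·u₂(θ₁) + u₂(δ)·w₁(θ₁)·w₁(θ₂) + u₂(δ)·w₂(θ₁)·w₂(θ₂)`.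
[cite: GlazmanManolescu2019, Proposition 3.1] -/
theorem yangBaxter_E0E2_E3E5 (θ₁ θ₂ : ℝ) (h₁ : weightDen θ₁ ≠ 0) (h₂ : weightDen θ₂ ≠ 0)
    (h₃ : weightDen (θ₂ - θ₁) ≠ 0) :
    weightU1 θ₁ * weightU2 θ₂ * weightW1 (θ₂ - θ₁) =
      weightU1 θ₂ * weightU2 θ₁ + weightU2 (θ₂ - θ₁) * weightW1 θ₁ * weightW1 θ₂ + weightU2 (θ₂ - θ₁) * weightW2 θ₁ * weightW2 θ₂ := by
  obtain ⟨_hi1, _hi2⟩ := den_ne_zero_complex h₁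
  obtain ⟨_hj1, _hj2⟩ := den_ne_zero_complex h₂
  obtain ⟨_hd1, _hd2⟩ := den_sub_ne_zero_complex h₃
  obtain ⟨_hd3, _hd4⟩ := den_ne_zero_complex h₃
  push_cast at _hd3 _hd4
  rw [exp_three_mul_sub_div_eight] at _hd3 _hd4
  apply Complex.ofReal_injective
  push_cast [weightU1, weightU2, weightW1, weightW2, weightDen]
  simp only [sin_shape1, sin_shape2, sin_shape3, sin_shape4, sin_shape5, sin_shape6, sin_shape7, sin_shape8, exp_three_mul_sub_div_eight]
  set ζ := cexp (↑π / 8 * I) with _hζ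
  set E₁ := cexp (3 * (θ₁ : ℂ) / 8 * I) with _hE₁
  set E₂ := cexp (3 * (θ₂ : ℂ) / 8 * I) with _hE₂
  have _hz : ζ ≠ 0 := exp_pi_div_eight_ne_zero
  have _hX₁ : E₁ ≠ 0 := exp_ne_zero _
  have _hX₂ : E₂ ≠ 0 := exp_ne_zero _
  have hred : ∀ n : ℕ, 8 ≤ n → ζ ^ n = -ζ ^ (n - 8) := exp_pi_div_eight_pow_red
  field_simp
  ring_nf
  simp (disch := decide) only [hred]
  ring_nf

/-- **Yang–Baxter equation, pairing `E0 ↔ E5, E2 ↔ E3`** (`k = 2`): in `𝖧` the families realising it weigh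
`u₁(θ₁)·u₂(θ₂)·w₂(δ) + u₂(δ)·v(θ₁)·v(θ₂)`, in `𝖧'` they weigh `u₂(δ)·w₁(θ₁)·w₂(θ₂)`.
[cite: GlazmanManolescu2019, Proposition 3.1] -/
theorem yangBaxter_E0E5_E2E3 (θ₁ θ₂ : ℝ) (h₁ : weightDen θ₁ ≠ 0) (h₂ : weightDen θ₂ ≠ 0)
    (h₃ : weightDen (θ₂ - θ₁) ≠ 0) :
    weightU1 θ₁ * weightU2 θ₂ * weightW2 (θ₂ - θ₁) + weightU2 (θ₂ - θ₁) * weightV θ₁ * weightV θ₂ =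
      weightU2 (θ₂ - θ₁) * weightW1 θ₁ * weightW2 θ₂ := by
  obtain ⟨_hi1, _hi2⟩ := den_ne_zero_complex h₁
  obtain ⟨_hj1, _hj2⟩ := den_ne_zero_complex h₂
  obtain ⟨_hd1, _hd2⟩ := den_sub_ne_zero_complex h₃
  obtain ⟨_hd3, _hd4⟩ := den_ne_zero_complex h₃
  push_cast at _hd3 _hd4
  rw [exp_three_mul_sub_div_eight] at _hd3 _hd4
  apply Complex.ofReal_injective
  push_cast [weightU1, weightU2, weightV, weightW1, weightW2, weightDen]
  simp only [sin_shape1, sin_shape2, sin_shape3, sin_shape4, sin_shape5, sin_shape6, sin_shape7, sin_shape8, exp_three_mul_sub_div_eight]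
  set ζ := cexp (↑π / 8 * I) with _hζ
  set E₁ := cexp (3 * (θ₁ : ℂ) / 8 * I) with _hE₁
  set E₂ := cexp (3 * (θ₂ : ℂ) / 8 * I) with _hE₂
  have _hz : ζ ≠ 0 := exp_pi_div_eight_ne_zero
  have _hX₁ : E₁ ≠ 0 := exp_ne_zero _
  have _hX₂ : E₂ ≠ 0 := exp_ne_zero _
  have hred : ∀ n : ℕ, 8 ≤ n → ζ ^ n = -ζ ^ (n - 8) := exp_pi_div_eight_pow_red
  field_simp
  ring_nf
  simp (disch := decide) only [hred]
  ring_nf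

/-- **Yang–Baxter equation, pairing `E0 ↔ E3, E4 ↔ E5`** (`k = 2`): in `𝖧` the families realising it weigh
`u₁(δ)·v(θ₁)·w₁(θ₂) + u₁(θ₁)·u₁(θ₂)·v(δ)`, in `𝖧'` they weigh `u₁(δ)·v(θ₂)·w₁(θ₁)`.
[cite: GlazmanManolescu2019, Proposition 3.1] -/
theorem yangBaxter_E0E3_E4E5 (θ₁ θ₂ : ℝ) (h₁ : weightDen θ₁ ≠ 0) (h₂ : weightDen θ₂ ≠ 0)
    (h₃ : weightDen (θ₂ - θ₁) ≠ 0) :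
    weightU1 (θ₂ - θ₁) * weightV θ₁ * weightW1 θ₂ + weightU1 θ₁ * weightU1 θ₂ * weightV (θ₂ - θ₁) =
      weightU1 (θ₂ - θ₁) * weightV θ₂ * weightW1 θ₁ := by
  obtain ⟨_hi1, _hi2⟩ := den_ne_zero_complex h₁
  obtain ⟨_hj1, _hj2⟩ := den_ne_zero_complex h₂
  obtain ⟨_hd1, _hd2⟩ := den_sub_ne_zero_complex h₃
  obtain ⟨_hd3, _hd4⟩ := den_ne_zero_complex h₃
  push_cast at _hd3 _hd4
  rw [exp_three_mul_sub_div_eight] at _hd3 _hd4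
  apply Complex.ofReal_injective
  push_cast [weightU1, weightV, weightW1, weightDen]
  simp only [sin_shape1, sin_shape2, sin_shape3, sin_shape4, sin_shape6, sin_shape7, exp_three_mul_sub_div_eight]
  set ζ := cexp (↑π / 8 * I) with _hζ
  set E₁ := cexp (3 * (θ₁ : ℂ) / 8 * I) with _hE₁
  set E₂ := cexp (3 * (θ₂ : ℂ) / 8 * I) with _hE₂
  have _hz : ζ ≠ 0 := exp_pi_div_eight_ne_zero
  have _hX₁ : E₁ ≠ 0 := exp_ne_zero _
  have _hX₂ : E₂ ≠ 0 := exp_ne_zero _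
  have hred : ∀ n : ℕ, 8 ≤ n → ζ ^ n = -ζ ^ (n - 8) := exp_pi_div_eight_pow_red
  field_simp
  ring_nf
  simp (disch := decide) only [hred]
  ring_nf

/-- **Yang–Baxter equation, pairing `E0 ↔ E4, E3 ↔ E5`** (`k = 2`): in `𝖧` the families realising it weigh
`u₁(δ)·v(θ₁)·w₂(θ₂)`, in `𝖧'` they weigh `u₁(δ)·v(θ₂)·w₂(θ₁) + u₂(θ₁)·u₂(θ₂)·v(δ)`.
[cite: GlazmanManolescu2019, Proposition 3.1] -/
theorem yangBaxter_E0E4_E3E5 (θ₁ θ₂ : ℝ) (h₁ : weightDen θ₁ ≠ 0) (h₂ : weightDen θ₂ ≠ 0)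
    (h₃ : weightDen (θ₂ - θ₁) ≠ 0) :
    weightU1 (θ₂ - θ₁) * weightV θ₁ * weightW2 θ₂ =
      weightU1 (θ₂ - θ₁) * weightV θ₂ * weightW2 θ₁ + weightU2 θ₁ * weightU2 θ₂ * weightV (θ₂ - θ₁) := by
  obtain ⟨_hi1, _hi2⟩ := den_ne_zero_complex h₁
  obtain ⟨_hj1, _hj2⟩ := den_ne_zero_complex h₂
  obtain ⟨_hd1, _hd2⟩ := den_sub_ne_zero_complex h₃
  obtain ⟨_hd3, _hd4⟩ := den_ne_zero_complex h₃
  push_cast at _hd3 _hd4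
  rw [exp_three_mul_sub_div_eight] at _hd3 _hd4
  apply Complex.ofReal_injective
  push_cast [weightU1, weightU2, weightV, weightW2, weightDen]
  simp only [sin_shape1, sin_shape2, sin_shape3, sin_shape4, sin_shape5, sin_shape6, sin_shape8, exp_three_mul_sub_div_eight]
  set ζ := cexp (↑π / 8 * I) with _hζ
  set E₁ := cexp (3 * (θ₁ : ℂ) / 8 * I) with _hE₁
  set E₂ := cexp (3 * (θ₂ : ℂ) / 8 * I) with _hE₂
  have _hz : ζ ≠ 0 := exp_pi_div_eight_ne_zero
  have _hX₁ : E₁ ≠ 0 := exp_ne_zero _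
  have _hX₂ : E₂ ≠ 0 := exp_ne_zero _
  have hred : ∀ n : ℕ, 8 ≤ n → ζ ^ n = -ζ ^ (n - 8) := exp_pi_div_eight_pow_red
  field_simp
  ring_nf
  simp (disch := decide) only [hred]
  ring_nf

/-- **Yang–Baxter equation, pairing `E1 ↔ E2, E3 ↔ E5`** (`k = 2`): in `𝖧` the families realising it weigh
`u₂(θ₂)·v(θ₁)·w₁(δ)`, in `𝖧'` they weigh `u₁(δ)·u₂(θ₁)·v(θ₂) + u₂(θ₂)·v(δ)·w₂(θ₁)`.
[cite: GlazmanManolescu2019, Proposition 3.1] -/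
theorem yangBaxter_E1E2_E3E5 (θ₁ θ₂ : ℝ) (h₁ : weightDen θ₁ ≠ 0) (h₂ : weightDen θ₂ ≠ 0)
    (h₃ : weightDen (θ₂ - θ₁) ≠ 0) :
    weightU2 θ₂ * weightV θ₁ * weightW1 (θ₂ - θ₁) =
      weightU1 (θ₂ - θ₁) * weightU2 θ₁ * weightV θ₂ + weightU2 θ₂ * weightV (θ₂ - θ₁) * weightW2 θ₁ := by
  obtain ⟨_hi1, _hi2⟩ := den_ne_zero_complex h₁
  obtain ⟨_hj1, _hj2⟩ := den_ne_zero_complex h₂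
  obtain ⟨_hd1, _hd2⟩ := den_sub_ne_zero_complex h₃
  obtain ⟨_hd3, _hd4⟩ := den_ne_zero_complex h₃
  push_cast at _hd3 _hd4
  rw [exp_three_mul_sub_div_eight] at _hd3 _hd4
  apply Complex.ofReal_injective
  push_cast [weightU1, weightU2, weightV, weightW1, weightW2, weightDen]
  simp only [sin_shape1, sin_shape2, sin_shape3, sin_shape4, sin_shape5, sin_shape6, sin_shape7, sin_shape8, exp_three_mul_sub_div_eight]
  set ζ := cexp (↑π / 8 * I) with _hζ
  set E₁ := cexp (3 * (θ₁ : ℂ) / 8 * I) with _hE₁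
  set E₂ := cexp (3 * (θ₂ : ℂ) / 8 * I) with _hE₂
  have _hz : ζ ≠ 0 := exp_pi_div_eight_ne_zero
  have _hX₁ : E₁ ≠ 0 := exp_ne_zero _
  have _hX₂ : E₂ ≠ 0 := exp_ne_zero _
  have hred : ∀ n : ℕ, 8 ≤ n → ζ ^ n = -ζ ^ (n - 8) := exp_pi_div_eight_pow_red
  field_simp
  ring_nf
  simp (disch := decide) only [hred]
  ring_nf

/-- **Yang–Baxter equation, pairing `E1 ↔ E5, E2 ↔ E3`** (`k = 2`): in `𝖧` the families realising it weigh
`u₁(θ₁)·u₂(δ)·v(θ₂) + u₂(θ₂)·v(θ₁)·w₂(δ)`, in `𝖧'` they weigh `u₂(θ₂)·v(δ)·w₁(θ₁)`.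
[cite: GlazmanManolescu2019, Proposition 3.1] -/
theorem yangBaxter_E1E5_E2E3 (θ₁ θ₂ : ℝ) (h₁ : weightDen θ₁ ≠ 0) (h₂ : weightDen θ₂ ≠ 0)
    (h₃ : weightDen (θ₂ - θ₁) ≠ 0) :
    weightU1 θ₁ * weightU2 (θ₂ - θ₁) * weightV θ₂ + weightU2 θ₂ * weightV θ₁ * weightW2 (θ₂ - θ₁) =
      weightU2 θ₂ * weightV (θ₂ - θ₁) * weightW1 θ₁ := by
  obtain ⟨_hi1, _hi2⟩ := den_ne_zero_complex h₁
  obtain ⟨_hj1, _hj2⟩ := den_ne_zero_complex h₂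
  obtain ⟨_hd1, _hd2⟩ := den_sub_ne_zero_complex h₃
  obtain ⟨_hd3, _hd4⟩ := den_ne_zero_complex h₃
  push_cast at _hd3 _hd4
  rw [exp_three_mul_sub_div_eight] at _hd3 _hd4
  apply Complex.ofReal_injective
  push_cast [weightU1, weightU2, weightV, weightW1, weightW2, weightDen]
  simp only [sin_shape1, sin_shape2, sin_shape3, sin_shape4, sin_shape5, sin_shape6, sin_shape7, sin_shape8, exp_three_mul_sub_div_eight]
  set ζ := cexp (↑π / 8 * I) with _hζ
  set E₁ := cexp (3 * (θ₁ : ℂ) / 8 * I) with _hE₁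
  set E₂ := cexp (3 * (θ₂ : ℂ) / 8 * I) with _hE₂
  have _hz : ζ ≠ 0 := exp_pi_div_eight_ne_zero
  have _hX₁ : E₁ ≠ 0 := exp_ne_zero _
  have _hX₂ : E₂ ≠ 0 := exp_ne_zero _
  have hred : ∀ n : ℕ, 8 ≤ n → ζ ^ n = -ζ ^ (n - 8) := exp_pi_div_eight_pow_red
  field_simp
  ring_nf
  simp (disch := decide) only [hred]
  ring_nf

/-- **Yang–Baxter equation, pairing `E1 ↔ E2, E4 ↔ E5`** (`k = 2`): in `𝖧` the families realising it weigh
`u₁(δ)·u₁(θ₂)·v(θ₁) + u₁(θ₁)·v(δ)·w₁(θ₂)`, in `𝖧'` they weigh `u₁(θ₁)·v(θ₂)·w₁(δ)`.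
[cite: GlazmanManolescu2019, Proposition 3.1] -/
theorem yangBaxter_E1E2_E4E5 (θ₁ θ₂ : ℝ) (h₁ : weightDen θ₁ ≠ 0) (h₂ : weightDen θ₂ ≠ 0)
    (h₃ : weightDen (θ₂ - θ₁) ≠ 0) :
    weightU1 (θ₂ - θ₁) * weightU1 θ₂ * weightV θ₁ + weightU1 θ₁ * weightV (θ₂ - θ₁) * weightW1 θ₂ =
      weightU1 θ₁ * weightV θ₂ * weightW1 (θ₂ - θ₁) := by
  obtain ⟨_hi1, _hi2⟩ := den_ne_zero_complex h₁
  obtain ⟨_hj1, _hj2⟩ := den_ne_zero_complex h₂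
  obtain ⟨_hd1, _hd2⟩ := den_sub_ne_zero_complex h₃
  obtain ⟨_hd3, _hd4⟩ := den_ne_zero_complex h₃
  push_cast at _hd3 _hd4
  rw [exp_three_mul_sub_div_eight] at _hd3 _hd4
  apply Complex.ofReal_injective
  push_cast [weightU1, weightV, weightW1, weightDen]
  simp only [sin_shape1, sin_shape2, sin_shape3, sin_shape4, sin_shape6, sin_shape7, exp_three_mul_sub_div_eight]
  set ζ := cexp (↑π / 8 * I) with _hζ
  set E₁ := cexp (3 * (θ₁ : ℂ) / 8 * I) with _hE₁
  set E₂ := cexp (3 * (θ₂ : ℂ) / 8 * I) with _hE₂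
  have _hz : ζ ≠ 0 := exp_pi_div_eight_ne_zero
  have _hX₁ : E₁ ≠ 0 := exp_ne_zero _
  have _hX₂ : E₂ ≠ 0 := exp_ne_zero _
  have hred : ∀ n : ℕ, 8 ≤ n → ζ ^ n = -ζ ^ (n - 8) := exp_pi_div_eight_pow_red
  field_simp
  ring_nf
  simp (disch := decide) only [hred]
  ring_nf

/-- **Yang–Baxter equation, pairing `E1 ↔ E4, E2 ↔ E5`** (`k = 2`): in `𝖧` the families realising it weigh
`u₁(θ₁)·v(δ)·w₂(θ₂)`, in `𝖧'` they weigh `u₁(θ₁)·v(θ₂)·w₂(δ) + u₂(δ)·u₂(θ₂)·v(θ₁)`.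
[cite: GlazmanManolescu2019, Proposition 3.1] -/
theorem yangBaxter_E1E4_E2E5 (θ₁ θ₂ : ℝ) (h₁ : weightDen θ₁ ≠ 0) (h₂ : weightDen θ₂ ≠ 0)
    (h₃ : weightDen (θ₂ - θ₁) ≠ 0) :
    weightU1 θ₁ * weightV (θ₂ - θ₁) * weightW2 θ₂ =
      weightU1 θ₁ * weightV θ₂ * weightW2 (θ₂ - θ₁) + weightU2 (θ₂ - θ₁) * weightU2 θ₂ * weightV θ₁ := by
  obtain ⟨_hi1, _hi2⟩ := den_ne_zero_complex h₁
  obtain ⟨_hj1, _hj2⟩ := den_ne_zero_complex h₂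
  obtain ⟨_hd1, _hd2⟩ := den_sub_ne_zero_complex h₃
  obtain ⟨_hd3, _hd4⟩ := den_ne_zero_complex h₃
  push_cast at _hd3 _hd4
  rw [exp_three_mul_sub_div_eight] at _hd3 _hd4
  apply Complex.ofReal_injective
  push_cast [weightU1, weightU2, weightV, weightW2, weightDen]
  simp only [sin_shape1, sin_shape2, sin_shape3, sin_shape4, sin_shape5, sin_shape6, sin_shape8, exp_three_mul_sub_div_eight]
  set ζ := cexp (↑π / 8 * I) with _hζ
  set E₁ := cexp (3 * (θ₁ : ℂ) / 8 * I) with _hE₁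
  set E₂ := cexp (3 * (θ₂ : ℂ) / 8 * I) with _hE₂
  have _hz : ζ ≠ 0 := exp_pi_div_eight_ne_zero
  have _hX₁ : E₁ ≠ 0 := exp_ne_zero _
  have _hX₂ : E₂ ≠ 0 := exp_ne_zero _
  have hred : ∀ n : ℕ, 8 ≤ n → ζ ^ n = -ζ ^ (n - 8) := exp_pi_div_eight_pow_red
  field_simp
  ring_nf
  simp (disch := decide) only [hred]
  ring_nf

/-- **Yang–Baxter equation, pairing `E1 ↔ E3, E4 ↔ E5`** (`k = 2`): in `𝖧` the families realising it weigh
`u₁(δ)·u₁(θ₁)·w₁(θ₂) + u₁(θ₂)·v(δ)·v(θ₁)`, in `𝖧'` they weigh `u₁(θ₂)·w₁(δ)·w₁(θ₁)`.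
[cite: GlazmanManolescu2019, Proposition 3.1] -/
theorem yangBaxter_E1E3_E4E5 (θ₁ θ₂ : ℝ) (h₁ : weightDen θ₁ ≠ 0) (h₂ : weightDen θ₂ ≠ 0)
    (h₃ : weightDen (θ₂ - θ₁) ≠ 0) :
    weightU1 (θ₂ - θ₁) * weightU1 θ₁ * weightW1 θ₂ + weightU1 θ₂ * weightV (θ₂ - θ₁) * weightV θ₁ =
      weightU1 θ₂ * weightW1 (θ₂ - θ₁) * weightW1 θ₁ := by
  obtain ⟨_hi1, _hi2⟩ := den_ne_zero_complex h₁
  obtain ⟨_hj1, _hj2⟩ := den_ne_zero_complex h₂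
  obtain ⟨_hd1, _hd2⟩ := den_sub_ne_zero_complex h₃
  obtain ⟨_hd3, _hd4⟩ := den_ne_zero_complex h₃
  push_cast at _hd3 _hd4
  rw [exp_three_mul_sub_div_eight] at _hd3 _hd4
  apply Complex.ofReal_injective
  push_cast [weightU1, weightV, weightW1, weightDen]
  simp only [sin_shape1, sin_shape2, sin_shape3, sin_shape4, sin_shape6, sin_shape7, exp_three_mul_sub_div_eight]
  set ζ := cexp (↑π / 8 * I) with _hζ
  set E₁ := cexp (3 * (θ₁ : ℂ) / 8 * I) with _hE₁
  set E₂ := cexp (3 * (θ₂ : ℂ) / 8 * I) with _hE₂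
  have _hz : ζ ≠ 0 := exp_pi_div_eight_ne_zero
  have _hX₁ : E₁ ≠ 0 := exp_ne_zero _
  have _hX₂ : E₂ ≠ 0 := exp_ne_zero _
  have hred : ∀ n : ℕ, 8 ≤ n → ζ ^ n = -ζ ^ (n - 8) := exp_pi_div_eight_pow_red
  field_simp
  ring_nf
  simp (disch := decide) only [hred]
  ring_nf

/-- **Yang–Baxter equation, pairing `E1 ↔ E4, E3 ↔ E5`** (`k = 2`): in `𝖧` the families realising it weigh
`u₁(δ)·u₁(θ₁)·w₂(θ₂)`, in `𝖧'` they weigh `u₁(θ₂)·w₁(δ)·w₂(θ₁) + u₁(θ₂)·w₁(θ₁)·w₂(δ) + u₂(δ)·u₂(θ₁)`.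
[cite: GlazmanManolescu2019, Proposition 3.1] -/
theorem yangBaxter_E1E4_E3E5 (θ₁ θ₂ : ℝ) (h₁ : weightDen θ₁ ≠ 0) (h₂ : weightDen θ₂ ≠ 0)
    (h₃ : weightDen (θ₂ - θ₁) ≠ 0) :
    weightU1 (θ₂ - θ₁) * weightU1 θ₁ * weightW2 θ₂ =
      weightU1 θ₂ * weightW1 (θ₂ - θ₁) * weightW2 θ₁ + weightU1 θ₂ * weightW1 θ₁ * weightW2 (θ₂ - θ₁) + weightU2 (θ₂ - θ₁) * weightU2 θ₁ := by
  obtain ⟨_hi1, _hi2⟩ := den_ne_zero_complex h₁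
  obtain ⟨_hj1, _hj2⟩ := den_ne_zero_complex h₂
  obtain ⟨_hd1, _hd2⟩ := den_sub_ne_zero_complex h₃
  obtain ⟨_hd3, _hd4⟩ := den_ne_zero_complex h₃
  push_cast at _hd3 _hd4
  rw [exp_three_mul_sub_div_eight] at _hd3 _hd4
  apply Complex.ofReal_injective
  push_cast [weightU1, weightU2, weightW1, weightW2, weightDen]
  simp only [sin_shape1, sin_shape2, sin_shape3, sin_shape4, sin_shape5, sin_shape6, sin_shape7, sin_shape8, exp_three_mul_sub_div_eight]
  set ζ := cexp (↑π / 8 * I) with _hζ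
  set E₁ := cexp (3 * (θ₁ : ℂ) / 8 * I) with _hE₁
  set E₂ := cexp (3 * (θ₂ : ℂ) / 8 * I) with _hE₂
  have _hz : ζ ≠ 0 := exp_pi_div_eight_ne_zero
  have _hX₁ : E₁ ≠ 0 := exp_ne_zero _
  have _hX₂ : E₂ ≠ 0 := exp_ne_zero _
  have hred : ∀ n : ℕ, 8 ≤ n → ζ ^ n = -ζ ^ (n - 8) := exp_pi_div_eight_pow_red
  field_simp
  ring_nf
  simp (disch := decide) only [hred]
  ring_nf

/-- **Yang–Baxter equation, pairing `E2 ↔ E3, E4 ↔ E5`** (`k = 2`): in `𝖧` the families realising it weigh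
`u₁(θ₂)·u₂(δ) + u₂(θ₁)·w₁(δ)·w₁(θ₂) + u₂(θ₁)·w₂(δ)·w₂(θ₂)`, in `𝖧'` they weigh `u₁(δ)·u₂(θ₂)·w₁(θ₁)`.
[cite: GlazmanManolescu2019, Proposition 3.1] -/
theorem yangBaxter_E2E3_E4E5 (θ₁ θ₂ : ℝ) (h₁ : weightDen θ₁ ≠ 0) (h₂ : weightDen θ₂ ≠ 0)
    (h₃ : weightDen (θ₂ - θ₁) ≠ 0) :
    weightU1 θ₂ * weightU2 (θ₂ - θ₁) + weightU2 θ₁ * weightW1 (θ₂ - θ₁) * weightW1 θ₂ + weightU2 θ₁ * weightW2 (θ₂ - θ₁) * weightW2 θ₂ =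
      weightU1 (θ₂ - θ₁) * weightU2 θ₂ * weightW1 θ₁ := by
  obtain ⟨_hi1, _hi2⟩ := den_ne_zero_complex h₁
  obtain ⟨_hj1, _hj2⟩ := den_ne_zero_complex h₂
  obtain ⟨_hd1, _hd2⟩ := den_sub_ne_zero_complex h₃
  obtain ⟨_hd3, _hd4⟩ := den_ne_zero_complex h₃
  push_cast at _hd3 _hd4
  rw [exp_three_mul_sub_div_eight] at _hd3 _hd4
  apply Complex.ofReal_injective
  push_cast [weightU1, weightU2, weightW1, weightW2, weightDen]
  simp only [sin_shape1, sin_shape2, sin_shape3, sin_shape4, sin_shape5, sin_shape6, sin_shape7, sin_shape8, exp_three_mul_sub_div_eight]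
  set ζ := cexp (↑π / 8 * I) with _hζ
  set E₁ := cexp (3 * (θ₁ : ℂ) / 8 * I) with _hE₁
  set E₂ := cexp (3 * (θ₂ : ℂ) / 8 * I) with _hE₂
  have _hz : ζ ≠ 0 := exp_pi_div_eight_ne_zero
  have _hX₁ : E₁ ≠ 0 := exp_ne_zero _
  have _hX₂ : E₂ ≠ 0 := exp_ne_zero _
  have hred : ∀ n : ℕ, 8 ≤ n → ζ ^ n = -ζ ^ (n - 8) := exp_pi_div_eight_pow_red
  field_simp
  ring_nf
  simp (disch := decide) only [hred]
  ring_nf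

/-- **Yang–Baxter equation, pairing `E2 ↔ E4, E3 ↔ E5`** (`k = 2`): in `𝖧` the families realising it weigh
`u₂(θ₁)·w₁(δ)·w₂(θ₂)`, in `𝖧'` they weigh `u₁(δ)·u₂(θ₂)·w₂(θ₁) + u₂(θ₁)·v(δ)·v(θ₂)`.
[cite: GlazmanManolescu2019, Proposition 3.1] -/
theorem yangBaxter_E2E4_E3E5 (θ₁ θ₂ : ℝ) (h₁ : weightDen θ₁ ≠ 0) (h₂ : weightDen θ₂ ≠ 0)
    (h₃ : weightDen (θ₂ - θ₁) ≠ 0) :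
    weightU2 θ₁ * weightW1 (θ₂ - θ₁) * weightW2 θ₂ =
      weightU1 (θ₂ - θ₁) * weightU2 θ₂ * weightW2 θ₁ + weightU2 θ₁ * weightV (θ₂ - θ₁) * weightV θ₂ := by
  obtain ⟨_hi1, _hi2⟩ := den_ne_zero_complex h₁
  obtain ⟨_hj1, _hj2⟩ := den_ne_zero_complex h₂
  obtain ⟨_hd1, _hd2⟩ := den_sub_ne_zero_complex h₃
  obtain ⟨_hd3, _hd4⟩ := den_ne_zero_complex h₃
  push_cast at _hd3 _hd4
  rw [exp_three_mul_sub_div_eight] at _hd3 _hd4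
  apply Complex.ofReal_injective
  push_cast [weightU1, weightU2, weightV, weightW1, weightW2, weightDen]
  simp only [sin_shape1, sin_shape2, sin_shape3, sin_shape4, sin_shape5, sin_shape6, sin_shape7, sin_shape8, exp_three_mul_sub_div_eight]
  set ζ := cexp (↑π / 8 * I) with _hζ
  set E₁ := cexp (3 * (θ₁ : ℂ) / 8 * I) with _hE₁
  set E₂ := cexp (3 * (θ₂ : ℂ) / 8 * I) with _hE₂
  have _hz : ζ ≠ 0 := exp_pi_div_eight_ne_zero
  have _hX₁ : E₁ ≠ 0 := exp_ne_zero _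
  have _hX₂ : E₂ ≠ 0 := exp_ne_zero _
  have hred : ∀ n : ℕ, 8 ≤ n → ζ ^ n = -ζ ^ (n - 8) := exp_pi_div_eight_pow_red
  field_simp
  ring_nf
  simp (disch := decide) only [hred]
  ring_nf

/-- **Yang–Baxter equation, pairing `E0 ↔ E1, E2 ↔ E3, E4 ↔ E5`** (`k = 3`): in `𝖧` the families realising it weigh
`u₁(θ₂)·u₂(δ)·u₂(θ₁) + w₁(δ)·w₁(θ₂)·w₂(θ₁) + w₁(θ₁)·w₁(θ₂)·w₂(δ) + w₂(δ)·w₂(θ₁)·w₂(θ₂)`, in `𝖧'` they weigh `w₁(δ)·w₁(θ₁)·w₂(θ₂)`.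
[cite: GlazmanManolescu2019, Proposition 3.1] -/
theorem yangBaxter_E0E1_E2E3_E4E5 (θ₁ θ₂ : ℝ) (h₁ : weightDen θ₁ ≠ 0) (h₂ : weightDen θ₂ ≠ 0)
    (h₃ : weightDen (θ₂ - θ₁) ≠ 0) :
    weightU1 θ₂ * weightU2 (θ₂ - θ₁) * weightU2 θ₁ + weightW1 (θ₂ - θ₁) * weightW1 θ₂ * weightW2 θ₁ + weightW1 θ₁ * weightW1 θ₂ * weightW2 (θ₂ - θ₁) + weightW2 (θ₂ - θ₁) * weightW2 θ₁ * weightW2 θ₂ =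
      weightW1 (θ₂ - θ₁) * weightW1 θ₁ * weightW2 θ₂ := by
  obtain ⟨_hi1, _hi2⟩ := den_ne_zero_complex h₁
  obtain ⟨_hj1, _hj2⟩ := den_ne_zero_complex h₂
  obtain ⟨_hd1, _hd2⟩ := den_sub_ne_zero_complex h₃
  obtain ⟨_hd3, _hd4⟩ := den_ne_zero_complex h₃
  push_cast at _hd3 _hd4
  rw [exp_three_mul_sub_div_eight] at _hd3 _hd4
  apply Complex.ofReal_injective
  push_cast [weightU1, weightU2, weightW1, weightW2, weightDen]
  simp only [sin_shape1, sin_shape2, sin_shape3, sin_shape4, sin_shape5, sin_shape6, sin_shape7, sin_shape8, exp_three_mul_sub_div_eight]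
  set ζ := cexp (↑π / 8 * I) with _hζ
  set E₁ := cexp (3 * (θ₁ : ℂ) / 8 * I) with _hE₁
  set E₂ := cexp (3 * (θ₂ : ℂ) / 8 * I) with _hE₂
  have _hz : ζ ≠ 0 := exp_pi_div_eight_ne_zero
  have _hX₁ : E₁ ≠ 0 := exp_ne_zero _
  have _hX₂ : E₂ ≠ 0 := exp_ne_zero _
  have hred : ∀ n : ℕ, 8 ≤ n → ζ ^ n = -ζ ^ (n - 8) := exp_pi_div_eight_pow_red
  field_simp
  ring_nf
  simp (disch := decide) only [hred]
  ring_nf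

/-- **Yang–Baxter equation, pairing `E0 ↔ E2, E1 ↔ E4, E3 ↔ E5`** (`k = 3`): in `𝖧` the families realising it weigh
`w₁(δ)·w₁(θ₁)·w₂(θ₂)`, in `𝖧'` they weigh `u₁(θ₂)·u₂(δ)·u₂(θ₁) + w₁(δ)·w₁(θ₂)·w₂(θ₁) + w₁(θ₁)·w₁(θ₂)·w₂(δ) + w₂(δ)·w₂(θ₁)·w₂(θ₂)`.
[cite: GlazmanManolescu2019, Proposition 3.1] -/
theorem yangBaxter_E0E2_E1E4_E3E5 (θ₁ θ₂ : ℝ) (h₁ : weightDen θ₁ ≠ 0) (h₂ : weightDen θ₂ ≠ 0)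
    (h₃ : weightDen (θ₂ - θ₁) ≠ 0) :
    weightW1 (θ₂ - θ₁) * weightW1 θ₁ * weightW2 θ₂ =
      weightU1 θ₂ * weightU2 (θ₂ - θ₁) * weightU2 θ₁ + weightW1 (θ₂ - θ₁) * weightW1 θ₂ * weightW2 θ₁ + weightW1 θ₁ * weightW1 θ₂ * weightW2 (θ₂ - θ₁) + weightW2 (θ₂ - θ₁) * weightW2 θ₁ * weightW2 θ₂ := by
  obtain ⟨_hi1, _hi2⟩ := den_ne_zero_complex h₁
  obtain ⟨_hj1, _hj2⟩ := den_ne_zero_complex h₂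
  obtain ⟨_hd1, _hd2⟩ := den_sub_ne_zero_complex h₃
  obtain ⟨_hd3, _hd4⟩ := den_ne_zero_complex h₃
  push_cast at _hd3 _hd4
  rw [exp_three_mul_sub_div_eight] at _hd3 _hd4
  apply Complex.ofReal_injective
  push_cast [weightU1, weightU2, weightW1, weightW2, weightDen]
  simp only [sin_shape1, sin_shape2, sin_shape3, sin_shape4, sin_shape5, sin_shape6, sin_shape7, sin_shape8, exp_three_mul_sub_div_eight]
  set ζ := cexp (↑π / 8 * I) with _hζ
  set E₁ := cexp (3 * (θ₁ : ℂ) / 8 * I) with _hE₁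
  set E₂ := cexp (3 * (θ₂ : ℂ) / 8 * I) with _hE₂
  have _hz : ζ ≠ 0 := exp_pi_div_eight_ne_zero
  have _hX₁ : E₁ ≠ 0 := exp_ne_zero _
  have _hX₂ : E₂ ≠ 0 := exp_ne_zero _
  have hred : ∀ n : ℕ, 8 ≤ n → ζ ^ n = -ζ ^ (n - 8) := exp_pi_div_eight_pow_red
  field_simp
  ring_nf
  simp (disch := decide) only [hred]
  ring_nf

end Literature.Probability.RandomPlanarGeometry.SAW.YangBaxter
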